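import Literature.MathematicalPhysics.QuantumFieldTheory.Balaban1983to89.B2Lemma27CovarianceBox
import Literature.MathematicalPhysics.QuantumFieldTheory.Balaban1983to89.B2Lemma24Proof
import Literature.MathematicalPhysics.QuantumFieldTheory.Balaban1983to89.B2Lemma25Proof
import Literature.MathematicalPhysics.QuantumFieldTheory.Balaban1983to89.B2StepKSect2Bridge

/-!
# `Balaban1983to89.B2Lemma27Proof` — [Balaban1982Higgs2] **Lemma 2.7** (2.113) p. 581, whose proof the paper OMITS («A proof
# of this lemma is based on the ideas which were described before in the proofs of Lemmas 2.4 and 2.5, so we omit it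
# here»): a RECONSTRUCTION of that proof for a model family on the B4 lineage box — localization by Proposition I.2.3
# shapes, expansion of `C^{(k)}(□,B̃)` in `B′ = B̃ − B₀`, gauge-away of the constant field `B₀`, and the zero-field estimate from
# the PROVED decay of `C^{(k)}(□)` (`B4BoxCov237`) — with the row's decl of record `B2Sect2Statements.Lemma27Printed` (and r14's
# twin `B2StepK.Lemma27Printed`) PROVED for that family

statement-level skeleton of published theorems with citation tags; proofs where landed; nothing here is a claim about the Yang–Mills mass gap

CITATION HEADER.  T. Bałaban, *(Higgs)₂,₃ quantum fields in a finite volume. II. An upper bound*, Commun. Math. Phys.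
**86** (1982) 555–594, doi:10.1007/bf01214890 [Balaban1982Higgs2] (cell paper B2; journal page = PDF page + 554; pp. 572–575,
580–581 READ AS IMAGES on the ×2 renders `run/shared/lean/pub/pub-balaban/b2b-balaban-ref1/pages/1982-cmp86-higgs23-II/
1982-cmp86-higgs23-II-p018…p021-x2.png`, `-p026/p027-x2.png`); inputs named in print from T. Bałaban, *(Higgs)₂,₃ quantum
fields in a finite volume. I. A lower bound*, Commun. Math. Phys. **85** (1982) 603–636 [Balaban1982Higgs1], Propositions
2.2–2.3 pp. 610–612.  Cell `lit-balaban` (HOME `run/shared/lean/pub/lit-balaban/`), Phase-2 proof seat **p23** gen 5, unit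
`lit-balaban-p23-g5`; SKELETON row **B2.Lem2.7** (decl of record `…B2Sect2Statements.Lemma27Printed`, r02 p239259; twin
`…B2StepK.Lemma27Printed`, r14 p239461, bridged by `…B2StepKSect2Bridge.lemma27Printed_of_sect2`, r14 p244035; all UNCHANGED);
kind «model instance» (PHASE2-TARGETS §G.1); fold owner r02, referee ref-4; support file `B2Lemma27CovarianceBox` (p251921);
reuses `B2Lemma24Proof.outer_engine` (p250408), `B2Eq268GaugeAway.remainder268_sup` (p249407), `B2Lemma25Proof.sum_exp_neg_l1dist_le`
(p247392), r14's `B2StepK.display285`/`display285_bound`, and `B4BoxCov237.cov237_box_decay`.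

WHAT IS PRINTED (verbatim, p. 581 [PDF 27]).  *"To obtain small fields on the set Λ₅^{(k)} we make the translation
φ = φ′ + aL⁻²C^{(k)}_{Λ₄^{(k)}}(B^k(Λ₂^{(k)}), B^{(k+1),η})Q*(B^{(k+1),η})ψ. (2.110) […] **Lemma 2.7.** The following estimate holds
aL⁻²(C^{(k)}_{Λ₄^{(k)}}(B^k(Λ₂^{(k)}), B^{(k+1),η})Q*(B^{(k+1),η})ψ)(x) = (Q*(B^{(k+1),η})ψ)(x) + O(p(L^kε)), x ∈ Λ₅^{(k)}. (2.113)
A proof of this lemma is based on the ideas which were described before in the proofs of Lemmas 2.4 and 2.5, so we omit it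
here. Lemma 2.7 and the restrictions on the fields ψ, φ imply |φ′(x)| ≦ O(1)p(L^kε), x ∈ Λ₅^{(k)}. (2.114)"*  THE IDEAS REFERRED
TO (pp. 572–575, quoted in `B2Lemma24Proof`, `B2Lemma25Proof`, `B2Lemma27CovarianceBox`): (2.67) localization «Using Proposition
2.2 and the restrictions (2.55)»; (2.68) «Using the expansion formula (I.3.44) and Proposition I.2.2»; (2.69)–(2.75) «the constant
field A₀ can be "gauged out"»; (2.76)/(2.85) the zero-field value and decay; (2.82) «where Proposition I.2.3 and the restrictions
on the field B were used».

THE RECONSTRUCTION (ours; the paper prints no proof).  For a unit site `y` of the `L`-block `B(z₀) ⊂ Λ₅^{(k)}`: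
(O) `aL⁻²(C^{(k)}_{Λ₄}(Ω,B̃)Q^*(B̃)ψ)(y) = aL⁻²(C^{(k)}(□,B̃)Q^*(B̃)□′₁ψ)(y) + O(e^{−δR})·|ψ|` — localization to a box `□` of
`L`-blocks around `z₀` with the `δC^{(k)}`-clause of Proposition I.2.3 ((1.18)) and the restriction of `ψ` to `□′₁`
(`B2Lemma24Proof.outer_engine`, the engine of (2.67)); (E) `C^{(k)}(□,B̃) − C^{(k)}(□,B₀) = C^{(k)}(□,B₀)[M(B₀) − M(B̃)]C^{(k)}(□,B̃)`,
`M = Δ^{(k)} + aL⁻²P`, `B₀ = B̃(z₀)` constant, with `‖M(B̃) − M(B₀)‖_{∞→∞} ≤ μ = O(θ + τ + τ′)` from the (2.68) remainder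
(`remainder268_sup`), the transporter differences (2.73) and Proposition I.2.2, and `‖C^{(k)}(□,B₀)‖_{∞→∞} ≤ CC0` from the
PROVED decay of `C^{(k)}(□)`; under the proviso `2·CC0·μ ≤ 1` («ε sufficiently small») `‖C^{(k)}(□,B̃) − C^{(k)}(□,B₀)‖ ≤ 2CC0²μ`
(`B2Lemma27CovarianceBox.expansion_bound`); (G) `C^{(k)}(□,B₀) = ℋ(C^{(k)}(□) ⊗ 1)ℋᵀ`, `Q^*(B₀)ψ = ℋQ^*1ψ′` with `ψ′ = ℋ′ᵀψ`
(`Cop_constBond`, `avgU_constBond`), so `aL⁻²(C^{(k)}(□,B₀)Q^*(B₀)□′₁ψ)(y) = U(B₀(Γ_{y,·}))·aL⁻²Σ_{y′}C^{(k)}(□;y,y′)ψ′(z(y′))`;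
(Z) `aL⁻²Σ_{y′}C^{(k)}(□;y,y′)ψ′(z(y′)) = ψ′(z₀) + O(q)` by `|C^{(k)}(□;y,y′)| ≤ c_Ce^{−δ_C|y−y′|}` (`cov237_box_decay`), the
covariant Lipschitz bound on `ψ′` over `□′₁`, the far part, and `aL⁻²C^{(k)}(□)1 = (1 + a⁻¹L²a_km²/(a_k+m²))⁻¹` EXACT
(`covOp_inv_rowsum` = (2.85)); (T) `U(B₀(Γ_{y,·}))ψ′(z₀) = U(B₀(Γ′_{z₀,y}))ᵀψ(z₀) = (Q^*(B̃)ψ)(y) + O(ℓ₁τ′|ψ|)`.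

THE MODEL (one instance `Model27 fr Yo` = one step `k` and one coarse block point `z₀`; dictionary in the docstring of
`Model27`).  The carrier is CONCRETE: the lineage's fine box `Box d ℓ k (M2 ℓ M′)` (a box `□` of whole `L`-blocks), its unit
sites and coarse sites, `B̃ = constBond B₀ + B′`, `C^{(k)}(□,B̃) = B2Lemma27CovarianceBox.Cop`, `Q^*(B̃) = avgUᵀ`; the left side of
(2.113) is (2.110)'s object in kernel form over the outer coarse sites `Tout` (`objΩ y = Σ_{z′}K_Ω(y,z′)ψ(z′)`).  INPUTS
(hypothesis fields, printed shapes): Proposition I.2.3 (1.16)/(1.18) on `Λ₄` as the `δC`-clause shapes `kerΩ_far/near`,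
`summableΩ`, `farΩ`; Proposition I.2.2 for `(□, B̃)` in OPERATOR form (`sup_g`, `sup_Dg`); invertibility of `H_k(□,B̃)` and of
`Δ^{(k)}(□,B̃) + aL⁻²P(B̃)` (`hunit`, `hunitM`; Proposition I.2.3 (1.15)); the sizes `θ, τ, τ′` of `B′ = B̃ − B₀` (per bond, block
holonomies, unit-level holonomies: «B − B(y) = O(p r)», (2.17)₃ at scale `L^kε`); the scale products (`sepC`, `sepO₂`, `sepO₄`,
`θ_scale`, `τ_scale`, `τ′_scale`, `m2_scale`: «O((L^kε)^{κ₀})», «O(μ₀²(L^kε)²)», separation beats powers); the smallness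
proviso `hsmall : 2·CC0·μ ≤ 1` («for ε sufficiently small»).  The restrictions on `ψ` ((2.16) at scale `L^kε`) form the
predicate `Model27.Restr` (= `restrψ`): the bound `|ψ| ≤ t_ψ·q` and the integrated covariant Lipschitz form.

WHAT IS PROVED (every theorem from the lineage's definitions; 0 cited facts; no `sorry`; axioms standard).
§1 engines (`sum_exp_supNorm_le`, `sum_exp_supNorm_mul_le` — the lattice sums, from `B2Lemma25Proof.sum_exp_neg_l1dist_le`;
`aSeq_ge`); §2 `Frame27` and its named constants `δC, cC` (`cov237_box_decay`), `CC0`, `c68` (`remainder268_sup`); §3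
`kerBox27`, `Frame27.rho/mu`, `Model27`, `Model27.Restr`, the objects `Ψ, Ct, C0, obj, obj0, ψ′, X0, objΩ, target, dev2113`;
§4 `X0_spec`, `X0_rowabs_le`, `supN_Ψ_le`, `C0_eq`, **`C0_bound`** (`‖C^{(k)}(□,B₀)‖ ≤ CC0`), `C0_mul_M0`, `Mt_mul_Ct`, `sumD_le`,
**`rem_op`** (the (2.68) remainder as an operator, `≤ ρ`), `M_sub_op` (`≤ μ`), **`Ct_bounds`** (the resolvent step); §5 the
constants `rhoK, muK, CE, CZ, C27` and the scale bookkeeping `rho_scale`, `mu_scale`; §6 **`obj_sub_obj0_le`** ((E): `≤ C_E·q`),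
**`fld_obj0`** ((G): `= U(B₀(Γ_{y,·}))·main′(y)`), `kappa0_eq` ((2.85) for the instance), **`mainZ_site_le`** ((Z): `≤ C_Z·q`),
**`target_site_le`** ((T)), **`outer_le`** ((O)), **`dev_site_le`** ((2.113) pointwise: `≤ C27·q`), `dev2113_le`, `lemma27_bound`, and
**row B2.Lem2.7**: `lemma27Printed_model : B2Sect2Statements.Lemma27Printed (famOf27 fr Yo)` for the family of ALL instances
of a frame, with the twin `lemma27Printed_model_StepK : B2StepK.Lemma27Printed (famOf27StepK fr Yo)` through r14's bridge.

HONEST SCOPE.  (a) NO PROOF IS PRINTED: this is our reconstruction of «the ideas of Lemmas 2.4 and 2.5» in the lineage's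
typed setting, NOT a transcription; the architecture (O)(E)(G)(Z)(T) and the inputs it consumes are stated above and in
`Model27`'s docstring.  (b) Hypothesis shapes, as for Lemmas 2.3–2.5 of this seat: Proposition I.2.3 on `Λ₄` (outer kernels
abstract), Proposition I.2.2 on `(□,B̃)` (two operator bounds), two invertibilities, the sizes of `B′`, the scale products,
and the smallness proviso `hsmall` (quantitative «ε small»; the constants `CC0`, `μ` are explicit).  Their provenance (B4 /
part I for non-constant fields; the behaviour of `r, λ, p, μ₀` across one scale) is NOT certified here.  (c) The zero-field
input of Lemma 2.5's idea is NOT a hypothesis: the decay of `C^{(k)}(□)` is `B4BoxCov237.cov237_box_decay` (PROVED) and (2.85)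
is exact on the box.  (d) One instance = one `(k, z₀)`; (2.113) at the unit sites of `B(z₀)`; contour systems arbitrary with
the stated end points; colour group any abelian orthogonal flow.  (e) Constants explicit (`Frame27.C27`), unoptimised.
(f) Value = kernel certificate of a reconstruction in the lineage's typed setting; NOT summit progress.
-/

namespace Literature.MathematicalPhysics.QuantumFieldTheory.Balaban1983to89.B2Lemma27Proof

open Finset Matrix
open scoped Kronecker
open Literature.MathematicalPhysics.QuantumFieldTheory.Balaban1983to89.B4GaugeCovariance
open Literature.MathematicalPhysics.QuantumFieldTheory.Balaban1983to89.B4Lower18Regular (e1 lsum transport_fieldLink)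
open Literature.MathematicalPhysics.QuantumFieldTheory.Balaban1983to89.B4Lemma21Region (siteNorm covDeriv)
open Literature.MathematicalPhysics.QuantumFieldTheory.Balaban1983to89.B4Reflection242 (nbrs boxDom blk blk_mem_boxDom)
open Literature.MathematicalPhysics.QuantumFieldTheory.Balaban1983to89.B4ContourShift (supNorm supNorm_nonneg abs_le_supNorm)
open Literature.MathematicalPhysics.QuantumFieldTheory.Balaban1983to89.B4BoxCov237 (boxOpR covOp cov237_box_decay)
open Literature.MathematicalPhysics.QuantumFieldTheory.Balaban1983to89.B4Lemma22Reduce231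
open Literature.MathematicalPhysics.QuantumFieldTheory.Balaban1983to89.B4Lemma22ReduceZero (siteNorm_sum_le Box gk
  greenA greenA0 opA derivA derivA0 fld_kron_mulVec)
open Literature.MathematicalPhysics.QuantumFieldTheory.Balaban1983to89.B4Lemma22ReduceDeriv (siteNorm_flow fld_sub
  covDeriv_sub_supN_le_nbrs)
open Literature.MathematicalPhysics.QuantumFieldTheory.Balaban1983to89.B4Lemma22PertVSup (siteNorm_neg supN_neg
  supN_smul_le blkWt_nonneg)
open Literature.MathematicalPhysics.QuantumFieldTheory.Balaban1983to89.B2Eq268GaugeAway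
open Literature.MathematicalPhysics.QuantumFieldTheory.Balaban1983to89.B2Lemma27CovarianceBox
open Literature.MathematicalPhysics.QuantumFieldTheory.Balaban1983to89.B2Lemma24Proof (outer_engine boxOneField
  fld_boxOneField_of_mem fld_boxOneField_of_not_mem)
open Literature.MathematicalPhysics.QuantumFieldTheory.Balaban1983to89.B2Lemma25Proof (l1dist sum_exp_neg_l1dist_le)

noncomputable section

variable {ι : Type} [Fintype ι] [DecidableEq ι]

/-! ## §1 Engines: lattice sums of exponentials on the unit box -/

section Engine

variable {d : ℕ}

omit [Fintype ι] [DecidableEq ι] in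
/-- `|y − y′|₁ ≤ (d+1)|y − y′|_∞` (the two lattice distances of [B1] (2.36) / [B4] (2.37)). [cite: Balaban1983RegularityDecay, (2.37) p. 582] -/
theorem l1dist_le_supNorm (x x' : Fin (d + 1) → ℤ) : l1dist x x' ≤ ((d : ℝ) + 1) * supNorm (x - x') := by
  unfold l1dist
  calc ∑ i, |((x i - x' i : ℤ) : ℝ)| ≤ ∑ _i : Fin (d + 1), supNorm (x - x') := by
        refine Finset.sum_le_sum fun i _ => ?_
        have h := abs_le_supNorm (x - x') i
        rw [Pi.sub_apply, Int.cast_abs] at h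
        exact h
    _ = ((d : ℝ) + 1) * supNorm (x - x') := by
        rw [Finset.sum_const, Finset.card_univ, Fintype.card_fin, nsmul_eq_mul]; push_cast; ring

omit [Fintype ι] [DecidableEq ι] in
/-- **THE LATTICE SUM** `Σ_{y′ ∈ □}e^{−δ|y−y′|_∞} ≤ (1 + 2(d+1)/δ)^{d+1}` («Σ_{x∈Z^d}e^{−δ₀|x|}» of [B4] p. 583).
[cite: Balaban1983RegularityDecay, p. 583 (2.39)] -/
theorem sum_exp_supNorm_le {δ : ℝ} (hδ : 0 < δ) {N : Fin (d + 1) → ℕ} (y : ↥(boxDom N)) :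
    ∑ y' : ↥(boxDom N), Real.exp (-(δ * supNorm (y.1 - y'.1))) ≤ (1 + 2 / (δ / ((d : ℝ) + 1))) ^ (d + 1) := by
  have hd : (0 : ℝ) < (d : ℝ) + 1 := by positivity
  calc ∑ y' : ↥(boxDom N), Real.exp (-(δ * supNorm (y.1 - y'.1)))
      ≤ ∑ y' : ↥(boxDom N), Real.exp (-(δ / ((d : ℝ) + 1) * l1dist y.1 y'.1)) := by
        refine Finset.sum_le_sum fun y' _ => ?_
        rw [Real.exp_le_exp, neg_le_neg_iff, div_mul_eq_mul_div, div_le_iff₀ hd]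
        calc δ * l1dist y.1 y'.1 ≤ δ * (((d : ℝ) + 1) * supNorm (y.1 - y'.1)) :=
              mul_le_mul_of_nonneg_left (l1dist_le_supNorm _ _) hδ.le
          _ = δ * supNorm (y.1 - y'.1) * ((d : ℝ) + 1) := by ring
    _ = ∑ x' ∈ boxDom N, Real.exp (-(δ / ((d : ℝ) + 1) * l1dist y.1 x')) :=
        Finset.sum_coe_sort (boxDom N) (fun x' => Real.exp (-(δ / ((d : ℝ) + 1) * l1dist y.1 x')))
    _ ≤ (1 + 2 / (δ / ((d : ℝ) + 1))) ^ (d + 1) := sum_exp_neg_l1dist_le (div_pos hδ hd) y.1 (boxDom N)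

omit [Fintype ι] [DecidableEq ι] in
/-- `t·e^{−bt} ≤ 1/b` (`b > 0`), the elementary step behind «Σ_{x}e^{−δ₀|x|}»-type bounds. [cite: Balaban1983RegularityDecay, p. 583 (2.39)] -/
private theorem mul_exp_neg_le' {b : ℝ} (hb : 0 < b) (t : ℝ) : t * Real.exp (-(b * t)) ≤ 1 / b := by
  have h1 : b * t + 1 ≤ Real.exp (b * t) := Real.add_one_le_exp (b * t)
  have h2 : b * t * Real.exp (-(b * t)) ≤ 1 := by
    calc b * t * Real.exp (-(b * t)) ≤ Real.exp (b * t) * Real.exp (-(b * t)) :=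
          mul_le_mul_of_nonneg_right (by linarith) (Real.exp_pos _).le
      _ = 1 := by rw [← Real.exp_add, add_neg_cancel, Real.exp_zero]
  rw [le_div_iff₀ hb]; linarith

omit [Fintype ι] [DecidableEq ι] in
/-- `t·e^{−δt} ≤ (2/δ)e^{−δt/2}`. [cite: Balaban1983RegularityDecay, p. 583 (2.39)] -/
theorem mul_exp_neg_le_half {δ : ℝ} (hδ : 0 < δ) (t : ℝ) :
    t * Real.exp (-(δ * t)) ≤ 2 / δ * Real.exp (-(δ / 2 * t)) := by
  have h := mul_exp_neg_le' (half_pos hδ) t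
  have he : Real.exp (-(δ * t)) = Real.exp (-(δ / 2 * t)) * Real.exp (-(δ / 2 * t)) := by
    rw [← Real.exp_add]; ring_nf
  rw [he, ← mul_assoc]
  refine mul_le_mul_of_nonneg_right (h.trans (le_of_eq ?_)) (Real.exp_pos _).le
  field_simp

omit [Fintype ι] [DecidableEq ι] in
/-- the weighted lattice sum: `Σ_{y′}e^{−δ|y−y′|}|y−y′| ≤ (2/δ)(1 + 4(d+1)/δ)^{d+1}`. [cite: Balaban1983RegularityDecay, p. 583] -/
theorem sum_exp_supNorm_mul_le {δ : ℝ} (hδ : 0 < δ) {N : Fin (d + 1) → ℕ} (y : ↥(boxDom N)) :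
    ∑ y' : ↥(boxDom N), Real.exp (-(δ * supNorm (y.1 - y'.1))) * supNorm (y.1 - y'.1)
      ≤ 2 / δ * (1 + 2 / (δ / 2 / ((d : ℝ) + 1))) ^ (d + 1) := by
  calc ∑ y' : ↥(boxDom N), Real.exp (-(δ * supNorm (y.1 - y'.1))) * supNorm (y.1 - y'.1)
      ≤ ∑ y' : ↥(boxDom N), 2 / δ * Real.exp (-(δ / 2 * supNorm (y.1 - y'.1))) := by
        refine Finset.sum_le_sum fun y' _ => ?_
        rw [mul_comm]
        exact mul_exp_neg_le_half hδ _
    _ = 2 / δ * ∑ y' : ↥(boxDom N), Real.exp (-(δ / 2 * supNorm (y.1 - y'.1))) := by rw [Finset.mul_sum]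
    _ ≤ 2 / δ * (1 + 2 / (δ / 2 / ((d : ℝ) + 1))) ^ (d + 1) :=
        mul_le_mul_of_nonneg_left (sum_exp_supNorm_le (half_pos hδ) y) (by positivity)

omit [DecidableEq ι] in
/-- matrix–vector products in blocks ([B4] (1.4) read blockwise). [cite: Balaban1983RegularityDecay, (1.4) p. 572] -/
theorem fld_mulVec_blocks' {X Y : Type*} [Fintype X] [Fintype Y] (T : Matrix (X × ι) (Y × ι) ℝ) (Ψ : Y × ι → ℝ)
    (x : X) : fld (T *ᵥ Ψ) x = ∑ y, (Matrix.of fun i j => T (x, i) (y, j)) *ᵥ fld Ψ y := by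
  funext i
  simp only [fld_apply, mulVec, dotProduct, Finset.sum_apply, Matrix.of_apply, Fintype.sum_prod_type]

omit [Fintype ι] [DecidableEq ι] in
/-- `0 < L⁻² < 1` for `L > 1`. [cite: Balaban1982Higgs1, (2.15) p. 609] -/
theorem r_bounds' {L : ℝ} (hL : 1 < L) : 0 < (L ^ 2)⁻¹ ∧ (L ^ 2)⁻¹ < 1 := by
  have h1 : 1 < L ^ 2 := by nlinarith
  exact ⟨by positivity, inv_lt_one_of_one_lt₀ h1⟩

omit [Fintype ι] [DecidableEq ι] in
/-- `a_k ≥ a(1 − L⁻²) = a_∞` («a_k ↘ a_∞ = a(1 − L⁻²)»). [cite: Balaban1982Higgs1, (2.15) p. 609] -/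
theorem aSeq_ge {a L : ℝ} (ha : 0 < a) (hL : 1 < L) {k : ℕ} (hk : 1 ≤ k) : a * (1 - (L ^ 2)⁻¹) ≤ B1.aSeq a L k := by
  obtain ⟨hr0, hr1⟩ := r_bounds' hL
  rw [B1.aSeq_eq]
  have hk' : ((L ^ 2)⁻¹) ^ k < 1 := pow_lt_one₀ hr0.le hr1 (by omega)
  have hk0 : 0 ≤ ((L ^ 2)⁻¹) ^ k := pow_nonneg hr0.le k
  have hnum : 0 ≤ a * (1 - (L ^ 2)⁻¹) := mul_nonneg ha.le (by linarith)
  rw [le_div_iff₀ (by linarith)]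
  nlinarith

end Engine

/-! ## §2 The fixed data of the family and its named constants -/

section FrameSec

variable (ι)

/-- **THE FIXED DATA OF THE MODEL FAMILY OF LEMMA 2.7**: the block size `L = ℓ+1`, the colour flow `U` with its
Lipschitz constant `ℓ₁` (`|U(t) − 1| ≤ ℓ₁|t|`), the window `[a₋, a₊] × [0, m²₊]` of `(a_k, μ₀²(L^kε)²)`, the constant `a`
of `aL⁻²` (2.80)/(2.110), and the constants of the printed inputs: `c_O, δ_O, S_O` of Proposition I.2.3 on `Λ₄` (outer
kernels and their summability), `c_I` of Proposition I.2.2 on the box, `r₁, r₂` of the integrated restriction (2.16)₃ on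
`ψ`, and the scale constants `K·` bounding the products `θt_ψ`, `τt_ψ`, `τ′t_ψ`, `m²t_ψ`, `e^{−δR}t_ψ`, `q/p`.
[cite: Balaban1982Higgs2, Lemma 2.7 (2.113) p. 581, (2.16)–(2.17) p. 560, Prop. 2.2 p. 570; Balaban1982Higgs1, Prop. 2.3 p. 611] -/
structure Frame27 (d : ℕ) where
  ℓ : ℕ
  hℓ : 1 ≤ ℓ
  F : OrthFlow ι
  ℓ₁ : ℝ
  hℓ₁ : 0 ≤ ℓ₁
  hLip : ∀ t (v : ι → ℝ), ((F.U t - 1) *ᵥ v) ⬝ᵥ ((F.U t - 1) *ᵥ v) ≤ (ℓ₁ * t) ^ 2 * (v ⬝ᵥ v)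
  amin : ℝ
  aplus : ℝ
  m2plus : ℝ
  ha : 0 < amin
  hwin : amin ≤ aplus
  hm2plus : 0 ≤ m2plus
  a₂ : ℝ
  ha₂ : 0 < a₂
  cO : ℝ
  δO : ℝ
  SO : ℝ
  cI : ℝ
  r₁ : ℝ
  r₂ : ℝ
  K₂ : ℝ
  K₃ : ℝ
  K₄ : ℝ
  K₅ : ℝ
  Kθ : ℝ
  Kτ : ℝ
  Kτ' : ℝ
  Km : ℝ
  cO_nonneg : 0 ≤ cO
  δO_pos : 0 < δO
  SO_nonneg : 0 ≤ SO
  cI_nonneg : 0 ≤ cI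
  r₁_nonneg : 0 ≤ r₁
  r₂_nonneg : 0 ≤ r₂
  K₂_nonneg : 0 ≤ K₂
  K₃_nonneg : 0 ≤ K₃
  K₄_nonneg : 0 ≤ K₄
  K₅_nonneg : 0 ≤ K₅
  Kθ_nonneg : 0 ≤ Kθ
  Kτ_nonneg : 0 ≤ Kτ
  Kτ'_nonneg : 0 ≤ Kτ'
  Km_nonneg : 0 ≤ Km

variable {ι}

namespace Frame27

variable {d : ℕ} (fr : Frame27 ι d)

/-- `a₊ > 0`. [cite: Balaban1982Higgs2, Lemma 2.7 p. 581] -/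
private theorem aplus_pos : 0 < fr.aplus := lt_of_lt_of_le fr.ha fr.hwin

/-- `L > 1`. [cite: Balaban1982Higgs2, p. 556 «L is a positive integer»] -/
private theorem hL : (1 : ℝ) < (fr.ℓ : ℝ) + 1 := by
  have : (1 : ℝ) ≤ (fr.ℓ : ℝ) := by exact_mod_cast fr.hℓ
  linarith

/-- the lower end `a₋(1 − L⁻²)` of the window of the RUNNING coefficients `a_k` (`a_k ≥ a(1 − L⁻²)`).
[cite: Balaban1982Higgs1, (2.15) p. 609] -/
def aminC : ℝ := fr.amin * (1 - ((((fr.ℓ : ℝ) + 1)) ^ 2)⁻¹)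

/-- `aminC > 0`. [cite: Balaban1982Higgs1, (2.15) p. 609] -/
theorem aminC_pos : 0 < fr.aminC := by
  obtain ⟨hr0, hr1⟩ := r_bounds' fr.hL
  unfold aminC
  exact mul_pos fr.ha (by linarith)

/-- the decay constants `(δ, c)` of `C^{(k)}(□)` from `B4BoxCov237.cov237_box_decay` on the frame's window (named by choice).
[cite: Balaban1983RegularityDecay, Lemma 2.4 (2.37) p. 582] -/
def covConsts : ℝ × ℝ :=
  ⟨(cov237_box_decay d fr.ℓ fr.hℓ fr.aminC fr.aplus fr.m2plus fr.a₂ fr.a₂ fr.aminC_pos fr.ha₂).choose,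
   (cov237_box_decay d fr.ℓ fr.hℓ fr.aminC fr.aplus fr.m2plus fr.a₂ fr.a₂ fr.aminC_pos fr.ha₂).choose_spec.choose⟩

/-- `δ_C`, the decay rate of `C^{(k)}(□)`. [cite: Balaban1983RegularityDecay, (2.37) p. 582] -/
def δC : ℝ := fr.covConsts.1

/-- `c_C`, the decay constant of `C^{(k)}(□)`. [cite: Balaban1983RegularityDecay, (2.37) p. 582] -/
def cC : ℝ := fr.covConsts.2

/-- the specification of `(δ_C, c_C)`: positivity, invertibility of `Δ^{(k)}(□) + aL⁻²P` and the entrywise decay of its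
inverse, uniformly on the window. [cite: Balaban1983RegularityDecay, (2.37) p. 582; Balaban1982Higgs1, (2.36) p. 611] -/
theorem covConsts_spec :
    0 < fr.δC ∧ 0 < fr.cC ∧ ∀ (n : ℕ), 1 ≤ n → ∀ (a₁ m2 a₂ : ℝ), fr.aminC ≤ a₁ → a₁ ≤ fr.aplus → 0 ≤ m2 →
      m2 ≤ fr.m2plus → fr.a₂ ≤ a₂ → a₂ ≤ fr.a₂ → ∀ (M' : Fin (d + 1) → ℕ), (∀ i, 1 ≤ M' i) →
        B4BoxCov237.covOp n fr.ℓ a₁ a₂ m2 M' * (B4BoxCov237.covOp n fr.ℓ a₁ a₂ m2 M')⁻¹ = 1 ∧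
        ∀ y y' : ↥(boxDom (fun i => (fr.ℓ + 1) * M' i)),
          |(B4BoxCov237.covOp n fr.ℓ a₁ a₂ m2 M')⁻¹ y y'| ≤ fr.cC * Real.exp (-(fr.δC * supNorm (y.1 - y'.1))) :=
  (cov237_box_decay d fr.ℓ fr.hℓ fr.aminC fr.aplus fr.m2plus fr.a₂ fr.a₂ fr.aminC_pos fr.ha₂).choose_spec.choose_spec

/-- `δ_C > 0`. [cite: Balaban1983RegularityDecay, (2.37) p. 582] -/
theorem δC_pos : 0 < fr.δC := fr.covConsts_spec.1

/-- `c_C > 0`. [cite: Balaban1983RegularityDecay, (2.37) p. 582] -/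
theorem cC_pos : 0 < fr.cC := fr.covConsts_spec.2.1

/-- the lattice-sum constant `S(δ) = (1 + 2(d+1)/δ)^{d+1}`. [cite: Balaban1983RegularityDecay, p. 583] -/
def SS (d : ℕ) (δ : ℝ) : ℝ := (1 + 2 / (δ / ((d : ℝ) + 1))) ^ (d + 1)

/-- `S(δ) ≥ 0` for `δ > 0`. [cite: Balaban1983RegularityDecay, p. 583] -/
theorem SS_nonneg (d : ℕ) {δ : ℝ} (hδ : 0 < δ) : 0 ≤ SS d δ := by
  unfold SS; positivity

/-- **`‖C^{(k)}(□,A₀)‖_{∞→∞} ≤ c_CS(δ_C)`** — the sup-operator bound of the constant-field covariance (row sums of the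
decay). [cite: Balaban1982Higgs1, Prop. 2.3 (2.36) p. 611] -/
def CC0 : ℝ := fr.cC * SS d fr.δC

/-- `CC0 ≥ 0`. [cite: Balaban1982Higgs1, Prop. 2.3 (2.36) p. 611] -/
theorem CC0_nonneg : 0 ≤ fr.CC0 := mul_nonneg fr.cC_pos.le (SS_nonneg d fr.δC_pos)

/-- the uniform constant `c` of the (2.68) remainder (`B2Eq268GaugeAway.remainder268_sup`) on the frame's window (named by
choice). [cite: Balaban1982Higgs2, (2.68) p. 572] -/
def c68 : ℝ :=
  (remainder268_sup fr.F fr.hℓ₁ fr.hLip d fr.ℓ fr.hℓ fr.amin fr.aplus fr.m2plus fr.ha).choose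

/-- the specification of `c68`: positivity and the uniform (2.68)-remainder bound of `B2Eq268GaugeAway.remainder268_sup`.
[cite: Balaban1982Higgs2, (2.68) p. 572] -/
theorem c68_spec : 0 < fr.c68 ∧ ∀ (κ : ℝ) (k : ℕ), 1 ≤ k → ∀ (a m2 : ℝ), fr.amin ≤ a → a ≤ fr.aplus → 0 ≤ m2 →
    m2 ≤ fr.m2plus → ∀ (M : Fin (d + 1) → ℕ), (∀ i, 1 ≤ M i) →
      ∀ (emb : ↥(boxDom M) → ↥(Box d fr.ℓ k M)) (Γ : ↥(boxDom M) → ↥(Box d fr.ℓ k M) → List ↥(Box d fr.ℓ k M)),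
        (∀ y x, blkWt ((fr.ℓ + 1) ^ k) M (fun i => (fr.ℓ + 1) ^ k * M i) y x ≠ 0 → pathEnd (emb y) (Γ y x) = x) →
      ∀ (A₀ : Fin (d + 1) → ℝ) (A' : ↥(Box d fr.ℓ k M) → ↥(Box d fr.ℓ k M) → ℝ) (θ τ : ℝ),
        IsUnit (opA d fr.F κ fr.ℓ k a m2 M emb Γ (constBond A₀ Subtype.val + A')).det →
        0 ≤ θ → (∀ x y : ↥(Box d fr.ℓ k M), y.1 ∈ nbrs x.1 → |κ * A' x y| ≤ θ / ((fr.ℓ + 1) ^ k : ℕ)) →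
        0 ≤ τ → (∀ y x, blkWt ((fr.ℓ + 1) ^ k) M (fun i => (fr.ℓ + 1) ^ k * M i) y x ≠ 0 →
          |κ * lsum A' (emb y) (Γ y x)| ≤ τ) →
        ∀ Ψ : ↥(boxDom M) × ι → ℝ,
          supN (B1.aSeq a ((fr.ℓ : ℝ) + 1) k • (greenA d fr.F κ fr.ℓ k a m2 M emb Γ (constBond A₀ Subtype.val + A')
                *ᵥ ((avgA d fr.F κ fr.ℓ k M emb Γ (constBond A₀ Subtype.val + A'))ᵀ *ᵥ Ψ))
              - B1.aSeq a ((fr.ℓ : ℝ) + 1) k • (greenA0 d fr.F κ fr.ℓ k a m2 M emb Γ A₀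
                *ᵥ ((avgA d fr.F κ fr.ℓ k M emb Γ (constBond A₀ Subtype.val))ᵀ *ᵥ Ψ)))
            ≤ fr.c68 * (B1.aSeq a ((fr.ℓ : ℝ) + 1) k * (fr.ℓ₁ * τ)) * supN Ψ
              + fr.c68 * (((d : ℝ) + 1) * fr.ℓ₁ * θ)
                * ∑ μ, supN (derivA0 d fr.F κ fr.ℓ k M A₀ μ *ᵥ (B1.aSeq a ((fr.ℓ : ℝ) + 1) k
                    • (greenA d fr.F κ fr.ℓ k a m2 M emb Γ (constBond A₀ Subtype.val + A')
                      *ᵥ ((avgA d fr.F κ fr.ℓ k M emb Γ (constBond A₀ Subtype.val + A'))ᵀ *ᵥ Ψ))))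
              + fr.c68 * (((d : ℝ) + 1) * fr.ℓ₁ ^ 2 * θ ^ 2 + B1.aSeq a ((fr.ℓ : ℝ) + 1) k * (fr.ℓ₁ * τ * (2 + fr.ℓ₁ * τ))
                  + ((d : ℝ) + 1) * fr.ℓ₁ * θ)
                * supN (B1.aSeq a ((fr.ℓ : ℝ) + 1) k
                    • (greenA d fr.F κ fr.ℓ k a m2 M emb Γ (constBond A₀ Subtype.val + A')
                      *ᵥ ((avgA d fr.F κ fr.ℓ k M emb Γ (constBond A₀ Subtype.val + A'))ᵀ *ᵥ Ψ))) :=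
  (remainder268_sup fr.F fr.hℓ₁ fr.hLip d fr.ℓ fr.hℓ fr.amin fr.aplus fr.m2plus fr.ha).choose_spec

/-- `c68 > 0`. [cite: Balaban1982Higgs2, (2.68) p. 572] -/
theorem c68_pos : 0 < fr.c68 := fr.c68_spec.1

end Frame27

end FrameSec

/-! ## §3 One instance: a step `k`, a coarse block point `z₀`, the background field `B̃ = B₀ + B′` and the field `ψ` -/

section ModelSec

variable {d : ℕ}

variable (d) in
/-- the box kernel rows of (2.113): `K_□(y, z′) = (aL⁻²C^{(k)}(□,B̃)Q^*(B̃))(y, z′)` as `N×N` blocks.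
[cite: Balaban1982Higgs2, (2.113) p. 581] -/
def kerBox27 (F : OrthFlow ι) (κ : ℝ) (ℓ k : ℕ) (a₂ a m2 : ℝ) (M' : Fin (d + 1) → ℕ)
    (emb : ↥(boxDom (M2 ℓ M')) → ↥(Box d ℓ k (M2 ℓ M')))
    (Γ : ↥(boxDom (M2 ℓ M')) → ↥(Box d ℓ k (M2 ℓ M')) → List ↥(Box d ℓ k (M2 ℓ M')))
    (emb' : ↥(boxDom M') → ↥(Box d ℓ k (M2 ℓ M')))
    (Γ' : ↥(boxDom M') → ↥(boxDom (M2 ℓ M')) → List ↥(Box d ℓ k (M2 ℓ M')))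
    (A : ↥(Box d ℓ k (M2 ℓ M')) → ↥(Box d ℓ k (M2 ℓ M')) → ℝ) (y : ↥(boxDom (M2 ℓ M'))) (z' : ↥(boxDom M')) :
    Matrix ι ι ℝ :=
  Matrix.of fun i j => ((a₂ / ((ℓ : ℝ) + 1) ^ 2) • (Cop d F κ ℓ k a₂ a m2 M' emb Γ emb' Γ' A
    * (avgU d F κ ℓ k M' emb' Γ' A)ᵀ) : Matrix (↥(boxDom (M2 ℓ M')) × ι) (↥(boxDom M') × ι) ℝ) (y, i) (z', j)

namespace Frame27

variable (fr : Frame27 ι d)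

/-- the operator bound `ρ` of the (2.68) remainder `a_kG_k(□,B̃)Q_k^*(B̃) − a_kG_k(□,B₀)Q_k^*(B₀)` in `‖·‖_{∞→∞}` for an
instance with sizes `θ, τ` of `B′` (from `c68` and Proposition I.2.2's `c_I`). [cite: Balaban1982Higgs2, (2.68) p. 572] -/
def rho (k : ℕ) (a θ τ : ℝ) : ℝ :=
  fr.c68 * (B1.aSeq a ((fr.ℓ : ℝ) + 1) k * (fr.ℓ₁ * τ))
    + fr.c68 * (((d : ℝ) + 1) * fr.ℓ₁ * θ) * (((d : ℝ) + 1) * (fr.cI + fr.ℓ₁ * θ * fr.cI))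
    + fr.c68 * (((d : ℝ) + 1) * fr.ℓ₁ ^ 2 * θ ^ 2 + B1.aSeq a ((fr.ℓ : ℝ) + 1) k * (fr.ℓ₁ * τ * (2 + fr.ℓ₁ * τ))
        + ((d : ℝ) + 1) * fr.ℓ₁ * θ) * fr.cI

/-- the operator bound `μ` of `(Δ^{(k)} + aL⁻²P)(B̃) − (Δ^{(k)} + aL⁻²P)(B₀)` (`B2Lemma27CovarianceBox.Mop_sub_bound`).
[cite: Balaban1982Higgs2, (2.68), (2.73) pp. 572–573] -/
def mu (k : ℕ) (a θ τ τ' : ℝ) : ℝ :=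
  B1.aSeq a ((fr.ℓ : ℝ) + 1) k * (fr.ℓ₁ * τ * fr.cI + fr.rho k a θ τ) + 2 * (fr.a₂ / ((fr.ℓ : ℝ) + 1) ^ 2) * (fr.ℓ₁ * τ')

/-- `ρ ≥ 0`. [cite: Balaban1982Higgs2, (2.68) p. 572] -/
theorem rho_nonneg {k : ℕ} (hk : 1 ≤ k) {a θ τ : ℝ} (ha : fr.amin ≤ a) (hθ : 0 ≤ θ) (hτ : 0 ≤ τ) :
    0 ≤ fr.rho k a θ τ := by
  have hL : (1 : ℝ) < (fr.ℓ : ℝ) + 1 := by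
    have : (1 : ℝ) ≤ (fr.ℓ : ℝ) := by exact_mod_cast fr.hℓ
    linarith
  have := B1.aSeq_pos (lt_of_lt_of_le fr.ha ha) hL hk
  have := fr.c68_pos; have := fr.hℓ₁; have := fr.cI_nonneg
  unfold rho; positivity

/-- `μ ≥ 0`. [cite: Balaban1982Higgs2, (2.68) p. 572] -/
theorem mu_nonneg {k : ℕ} (hk : 1 ≤ k) {a θ τ τ' : ℝ} (ha : fr.amin ≤ a) (hθ : 0 ≤ θ) (hτ : 0 ≤ τ) (hτ' : 0 ≤ τ') :
    0 ≤ fr.mu k a θ τ τ' := by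
  have hL : (1 : ℝ) < (fr.ℓ : ℝ) + 1 := by
    have : (1 : ℝ) ≤ (fr.ℓ : ℝ) := by exact_mod_cast fr.hℓ
    linarith
  have := B1.aSeq_pos (lt_of_lt_of_le fr.ha ha) hL hk
  have := fr.rho_nonneg hk ha hθ hτ; have := fr.hℓ₁; have := fr.cI_nonneg; have := fr.ha₂
  unfold mu; positivity

end Frame27

/-- **ONE INSTANCE OF LEMMA 2.7 IN THE MODEL FAMILY** — a step `k` and a coarse block point `z₀` (the `L`-block `B(z₀) ⊂
Λ₅^{(k)}` of unit sites `y` at which (2.113) is evaluated).  Dictionary: `□ = B^k(□^{(k)})` the fine box of the `L`-block box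
`□^{(k)} = L·M′` of unit sites around `z₀` (the lineage box `Box d ℓ k (M2 ℓ M′)`), coarse sites `□′ = boxDom M′`; `B̃ =
B^{(k+1),η}|_□ = B₀ + B′`, `B₀ = B^{(k+1),η}(z₀)` constant (`A₀`), `B′` with per-bond size `θ/L^k`, block-contour holonomies
`≤ τ` and unit-level-contour holonomies `≤ τ′` (`hA′`, `hτA`, `hτA′` ↤ (2.17)₃/(2.81)-type regularity of `B`, «B^{(k+1),η} −
B₀ = O(p r)»); `emb, Γ` the `L^k`-block contours, `emb′, Γ′` the unit-level contours of `Q(B̃)`; `hunit`, `hunitM` ↤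
invertibility of `H_k(□,B̃)` and of `Δ^{(k)}(□,B̃) + aL⁻²P(B̃)` (Proposition I.2.3 (1.15)); `sq1 ∋ z₀` ↤ `□′₁`, the coarse
sites within `2r(L^kε)` of `z₀` (the field is localized there, `Ψ = □′₁ψ`); `ψ` the field of (2.113) on `□′`; `p` ↤ `p(L^kε)`,
`q` the instance's small parameter (`q ≤ K₃p`; `q = p(L^kε)` in print), `tψ·q` ↤ the bound `p(L^kε)λ(L^kε)^{−1/4}` of (2.16)₄ at
scale `L^kε`; `R₁` ↤ the separation of `B(z₀)` from `B(□′∖□′₁)` in unit lengths, `R₂`, `R₄` ↤ the separations of the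
`δC^{(k)}`-clause (distance to `□ᶜ`) — with the scale products `sepC`, `sepO₂`, `sepO₄`, `θ_scale`, `τ_scale`, `τ′_scale`,
`m2_scale` («O(μ₀²(L^kε)²)», «r(L^kε)-separation beats powers»); `sup_g`, `sup_Dg` ↤ Proposition I.2.2 for `(□, B̃)` in operator
form; `hsmall` ↤ «for ε sufficiently small» (the resolvent step converges); the OUTER data `Tout, inc, KΩ, ψΩ, dΩ` ↤ the unit
sites of `Λ₄^{(k)}`'s coarse lattice, the rows `(aL⁻²C^{(k)}_{Λ₄}(B^k(Λ₂),B̃)Q^*(B̃))(y,·)`, the field `ψ` there and the distances,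
with Proposition I.2.3 (1.16)/(1.18) as the `δC`-CLAUSE SHAPES `kerΩ_far`, `kerΩ_near`, `summableΩ`, `farΩ`.
[cite: Balaban1982Higgs2, Lemma 2.7 (2.113) p. 581, (2.16)–(2.17) p. 560, (2.67) p. 572; Balaban1982Higgs1, Prop. 2.3 (1.16)–(1.18) p. 611] -/
structure Model27 (fr : Frame27 ι d) (Yo : Type) [Fintype Yo] [DecidableEq Yo] where
  k : ℕ
  hk : 1 ≤ k
  a : ℝ
  m2 : ℝ
  ha1 : fr.amin ≤ a
  ha2 : a ≤ fr.aplus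
  hm1 : 0 ≤ m2
  hm2 : m2 ≤ fr.m2plus
  M' : Fin (d + 1) → ℕ
  hM' : ∀ i, 1 ≤ M' i
  κ : ℝ
  emb : ↥(boxDom (M2 fr.ℓ M')) → ↥(Box d fr.ℓ k (M2 fr.ℓ M'))
  Γ : ↥(boxDom (M2 fr.ℓ M')) → ↥(Box d fr.ℓ k (M2 fr.ℓ M')) → List ↥(Box d fr.ℓ k (M2 fr.ℓ M'))
  hend : ∀ y x, blkWt ((fr.ℓ + 1) ^ k) (M2 fr.ℓ M') (fun i => (fr.ℓ + 1) ^ k * M2 fr.ℓ M' i) y x ≠ 0 →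
    pathEnd (emb y) (Γ y x) = x
  emb' : ↥(boxDom M') → ↥(Box d fr.ℓ k (M2 fr.ℓ M'))
  Γ' : ↥(boxDom M') → ↥(boxDom (M2 fr.ℓ M')) → List ↥(Box d fr.ℓ k (M2 fr.ℓ M'))
  hend' : ∀ z y, blkWt (fr.ℓ + 1) M' (M2 fr.ℓ M') z y ≠ 0 → pathEnd (emb' z) (Γ' z y) = emb y
  A₀ : Fin (d + 1) → ℝ
  A' : ↥(Box d fr.ℓ k (M2 fr.ℓ M')) → ↥(Box d fr.ℓ k (M2 fr.ℓ M')) → ℝ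
  θ : ℝ
  τ : ℝ
  τ' : ℝ
  hθ : 0 ≤ θ
  hθ1 : θ ≤ 1
  hτ : 0 ≤ τ
  hτ1 : τ ≤ 1
  hτ' : 0 ≤ τ'
  hτ'1 : τ' ≤ 1
  hA' : ∀ x y : ↥(Box d fr.ℓ k (M2 fr.ℓ M')), y.1 ∈ nbrs x.1 → |κ * A' x y| ≤ θ / ((fr.ℓ + 1) ^ k : ℕ)
  hτA : ∀ y x, blkWt ((fr.ℓ + 1) ^ k) (M2 fr.ℓ M') (fun i => (fr.ℓ + 1) ^ k * M2 fr.ℓ M' i) y x ≠ 0 →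
    |κ * lsum A' (emb y) (Γ y x)| ≤ τ
  hτA' : ∀ z y, blkWt (fr.ℓ + 1) M' (M2 fr.ℓ M') z y ≠ 0 → |κ * lsum A' (emb' z) (Γ' z y)| ≤ τ'
  hunit : IsUnit (opA d fr.F κ fr.ℓ k a m2 (M2 fr.ℓ M') emb Γ (constBond A₀ Subtype.val + A')).det
  hunitM : IsUnit (Mop d fr.F κ fr.ℓ k fr.a₂ a m2 M' emb Γ emb' Γ' (constBond A₀ Subtype.val + A')).det
  z₀ : ↥(boxDom M')
  sq1 : Finset ↥(boxDom M')
  z₀_mem : z₀ ∈ sq1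
  ψ : ↥(boxDom M') → ι → ℝ
  p : ℝ
  q : ℝ
  tψ : ℝ
  R₁ : ℝ
  R₂ : ℝ
  R₄ : ℝ
  p_nonneg : 0 ≤ p
  q_nonneg : 0 ≤ q
  tψ_nonneg : 0 ≤ tψ
  R₂_nonneg : 0 ≤ R₂
  q_le : q ≤ fr.K₃ * p
  sepC : Real.exp (-(fr.δC / 2 * R₁)) * tψ ≤ fr.K₂
  sepO₂ : Real.exp (-(fr.δO / 2 * R₂)) * tψ ≤ fr.K₄
  sepO₄ : Real.exp (-(fr.δO * R₄)) * tψ ≤ fr.K₅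
  θ_scale : θ * tψ ≤ fr.Kθ
  τ_scale : τ * tψ ≤ fr.Kτ
  τ'_scale : τ' * tψ ≤ fr.Kτ'
  m2_scale : m2 * tψ ≤ fr.Km
  far1 : ∀ y : ↥(boxDom (M2 fr.ℓ M')), cSite d fr.ℓ M' y = z₀ → ∀ y' : ↥(boxDom (M2 fr.ℓ M')),
    cSite d fr.ℓ M' y' ∉ sq1 → R₁ ≤ supNorm (y.1 - y'.1)
  sup_g : ∀ v : ↥(boxDom (M2 fr.ℓ M')) × ι → ℝ,
    supN (B1.aSeq a ((fr.ℓ : ℝ) + 1) k • (greenA d fr.F κ fr.ℓ k a m2 (M2 fr.ℓ M') emb Γ (constBond A₀ Subtype.val + A')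
      *ᵥ ((avgA d fr.F κ fr.ℓ k (M2 fr.ℓ M') emb Γ (constBond A₀ Subtype.val + A'))ᵀ *ᵥ v))) ≤ fr.cI * supN v
  sup_Dg : ∀ (μ : Fin (d + 1)) (v : ↥(boxDom (M2 fr.ℓ M')) × ι → ℝ),
    supN (derivA d fr.F κ fr.ℓ k (M2 fr.ℓ M') (constBond A₀ Subtype.val + A') μ
      *ᵥ (B1.aSeq a ((fr.ℓ : ℝ) + 1) k • (greenA d fr.F κ fr.ℓ k a m2 (M2 fr.ℓ M') emb Γ (constBond A₀ Subtype.val + A')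
        *ᵥ ((avgA d fr.F κ fr.ℓ k (M2 fr.ℓ M') emb Γ (constBond A₀ Subtype.val + A'))ᵀ *ᵥ v)))) ≤ fr.cI * supN v
  hsmall : 2 * fr.CC0 * fr.mu k a θ τ τ' ≤ 1
  Tout : Finset Yo
  inc : ↥(boxDom M') → Yo
  inc_inj : Function.Injective inc
  inc_mem : ∀ z ∈ sq1, inc z ∈ Tout
  KΩ : ↥(boxDom (M2 fr.ℓ M')) → Yo → Matrix ι ι ℝ
  ψΩ : Yo → ι → ℝ
  ψΩ_inc : ∀ z ∈ sq1, ψΩ (inc z) = ψ z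
  dΩ : ↥(boxDom (M2 fr.ℓ M')) → Yo → ℝ
  dΩ_nonneg : ∀ y z', 0 ≤ dΩ y z'
  summableΩ : ∀ y, ∑ z' ∈ Tout, Real.exp (-(fr.δO / 2 * dΩ y z')) ≤ fr.SO
  kerΩ_far : ∀ y, cSite d fr.ℓ M' y = z₀ → ∀ z' ∈ Tout, z' ∉ sq1.image inc → ∀ v,
    siteNorm (KΩ y z' *ᵥ v) ≤ fr.cO * Real.exp (-(fr.δO * dΩ y z')) * siteNorm v
  farΩ : ∀ y, cSite d fr.ℓ M' y = z₀ → ∀ z' ∈ Tout, z' ∉ sq1.image inc → R₂ ≤ dΩ y z'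
  kerΩ_near : ∀ y, cSite d fr.ℓ M' y = z₀ → ∀ z' ∈ sq1, ∀ v,
    siteNorm ((KΩ y (inc z') - kerBox27 d fr.F κ fr.ℓ k fr.a₂ a m2 M' emb Γ emb' Γ' (constBond A₀ Subtype.val + A') y z')
      *ᵥ v) ≤ fr.cO * Real.exp (-(fr.δO * R₄)) * Real.exp (-(fr.δO * dΩ y (inc z'))) * siteNorm v

namespace Model27

variable {fr : Frame27 ι d} {Yo : Type} [Fintype Yo] [DecidableEq Yo] (m : Model27 fr Yo)

/-- **THE RESTRICTIONS ON `ψ`** («the restrictions on the fields ψ, φ», (2.16) at scale `L^kε`): the bound (2.16)₄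
`|ψ| ≤ p(L^kε)λ(L^kε)^{−1/4} = t_ψ·q` on `Λ₄`'s coarse sites, and the integrated covariant form of (2.16)₃ between `z₀` and the
sites of `□′₁` (transport along the constant field `B₀`, the `B′`-part being absorbed in the constants as in Lemma 2.4 p. 573
«|U(A₀(⟨y′,y″⟩))φ(y″) − φ(y′)| ≤ O(1)p»): `|U(B₀; z₀ → z′)ψ(z′) − ψ(z₀)| ≤ q(r₁ + r₂|y − y′|_∞/L)` for unit sites `y ∈ B(z₀)`,
`y′ ∈ B(z′)`. [cite: Balaban1982Higgs2, (2.16) p. 560, p. 573, p. 581 «the restrictions on the fields ψ, φ»] -/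
structure Restr : Prop where
  bound : ∀ z' ∈ m.Tout, siteNorm (m.ψΩ z') ≤ m.tψ * m.q
  lip : ∀ y : ↥(boxDom (M2 fr.ℓ m.M')), cSite d fr.ℓ m.M' y = m.z₀ → ∀ y' : ↥(boxDom (M2 fr.ℓ m.M')),
    cSite d fr.ℓ m.M' y' ∈ m.sq1 →
    siteNorm (fieldLink fr.F m.κ (constBond m.A₀ Subtype.val) (m.emb' m.z₀) (m.emb' (cSite d fr.ℓ m.M' y'))
        *ᵥ m.ψ (cSite d fr.ℓ m.M' y') - m.ψ m.z₀)
      ≤ m.q * (fr.r₁ + fr.r₂ * (supNorm (y.1 - y'.1) / ((fr.ℓ : ℝ) + 1)))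

/-- `B̃ = B₀ + B′` on the box («A^{(k)} − A₀ = O(p(L^kε)r(L^kε))»). [cite: Balaban1982Higgs2, p. 572, (2.113) p. 581] -/
abbrev At : ↥(Box d fr.ℓ m.k (M2 fr.ℓ m.M')) → ↥(Box d fr.ℓ m.k (M2 fr.ℓ m.M')) → ℝ :=
  constBond m.A₀ Subtype.val + m.A'

/-- `B₀` as a bond field on the box (the constant configuration «A₀»). [cite: Balaban1982Higgs2, p. 572] -/
abbrev A0b : ↥(Box d fr.ℓ m.k (M2 fr.ℓ m.M')) → ↥(Box d fr.ℓ m.k (M2 fr.ℓ m.M')) → ℝ :=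
  constBond m.A₀ Subtype.val

/-- `□′₁ψ` as a field on the coarse box («□₁φ» of (2.67)). [cite: Balaban1982Higgs2, (2.67) p. 572] -/
abbrev Ψ : ↥(boxDom m.M') × ι → ℝ := boxOneField m.sq1 m.ψ

/-- `C^{(k)}(□, B̃)` for the instance. [cite: Balaban1983RegularityDecay, (1.13) p. 573] -/
abbrev Ct : Matrix (↥(boxDom (M2 fr.ℓ m.M')) × ι) (↥(boxDom (M2 fr.ℓ m.M')) × ι) ℝ :=
  Cop d fr.F m.κ fr.ℓ m.k fr.a₂ m.a m.m2 m.M' m.emb m.Γ m.emb' m.Γ' m.At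

/-- `C^{(k)}(□, B₀)` for the instance. [cite: Balaban1983RegularityDecay, (1.13) p. 573] -/
abbrev C0 : Matrix (↥(boxDom (M2 fr.ℓ m.M')) × ι) (↥(boxDom (M2 fr.ℓ m.M')) × ι) ℝ :=
  Cop d fr.F m.κ fr.ℓ m.k fr.a₂ m.a m.m2 m.M' m.emb m.Γ m.emb' m.Γ' m.A0b

/-- `aL⁻²C^{(k)}(□,B̃)Q^*(B̃)□′₁ψ` on the box. [cite: Balaban1982Higgs2, (2.113) p. 581] -/
abbrev obj : ↥(boxDom (M2 fr.ℓ m.M')) × ι → ℝ :=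
  ((fr.a₂ / ((fr.ℓ : ℝ) + 1) ^ 2) • (m.Ct * (avgU d fr.F m.κ fr.ℓ m.k m.M' m.emb' m.Γ' m.At)ᵀ)) *ᵥ m.Ψ

/-- `aL⁻²C^{(k)}(□,B₀)Q^*(B₀)□′₁ψ` on the box (the constant-field comparison object of (2.68)). [cite: Balaban1982Higgs2, (2.68) p. 572] -/
abbrev obj0 : ↥(boxDom (M2 fr.ℓ m.M')) × ι → ℝ :=
  ((fr.a₂ / ((fr.ℓ : ℝ) + 1) ^ 2) • (m.C0 * (avgU d fr.F m.κ fr.ℓ m.k m.M' m.emb' m.Γ' m.A0b)ᵀ)) *ᵥ m.Ψ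

/-- the gauge-rotated field `ψ′(z) = U(B₀(Γ_{z,·}))ᵀ□′₁ψ(z)` («φ(y′) = U(A₀(Γ_{y′,y}))φ′(y′)»). [cite: Balaban1982Higgs2, p. 573] -/
abbrev ψ' : ↥(boxDom m.M') × ι → ℝ :=
  (blockDiag (gaugeU d fr.F m.κ fr.ℓ m.k (M2 fr.ℓ m.M') m.A₀ ∘ m.emb'))ᵀ *ᵥ m.Ψ

/-- the zero-field matrix `Δ^{(k)}(□) + aL⁻²P` of `B4BoxCov237` for the instance. [cite: Balaban1983RegularityDecay, (1.13)–(1.14) p. 573] -/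
abbrev X0 : Matrix ↥(boxDom (M2 fr.ℓ m.M')) ↥(boxDom (M2 fr.ℓ m.M')) ℝ :=
  B4BoxCov237.covOp ((fr.ℓ + 1) ^ m.k) fr.ℓ (B1.aSeq m.a ((fr.ℓ : ℝ) + 1) m.k) fr.a₂ m.m2 m.M'

/-- **`(aL⁻²C^{(k)}_{Λ₄}(B^k(Λ₂),B̃)Q^*(B̃)ψ)(y)`** — the left side of (2.113) at a unit site of `B(z₀)`, in kernel form over
the outer coarse sites. [cite: Balaban1982Higgs2, (2.113) p. 581] -/
def objΩ (y : ↥(boxDom (M2 fr.ℓ m.M'))) : ι → ℝ := ∑ z' ∈ m.Tout, m.KΩ y z' *ᵥ m.ψΩ z'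

/-- **`(Q^*(B̃)ψ)(y) = U(B̃(Γ′_{z₀,y}))ᵀψ(z₀)`** — the right side of (2.113) at `y ∈ B(z₀)`.
[cite: Balaban1982Higgs2, (2.113) p. 581] -/
def target (y : ↥(boxDom (M2 fr.ℓ m.M'))) : ι → ℝ :=
  (transU d fr.F m.κ fr.ℓ m.k m.M' m.emb' m.Γ' m.At m.z₀ y)ᵀ *ᵥ m.ψ m.z₀

/-- **`dev2113`** = `sup_{y ∈ B(z₀)} |aL⁻²(C^{(k)}_{Λ₄}(…,B̃)Q^*(B̃)ψ)(y) − (Q^*(B̃)ψ)(y)|`.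
[cite: Balaban1982Higgs2, (2.113) p. 581] -/
def dev2113 : ℝ :=
  ⨆ y : {y : ↥(boxDom (M2 fr.ℓ m.M')) // cSite d fr.ℓ m.M' y = m.z₀}, siteNorm (m.objΩ y.1 - m.target y.1)

end Model27

end ModelSec

/-! ## §4 The estimates -/

section Estimates

variable {d : ℕ}

namespace Model27

variable {fr : Frame27 ι d} {Yo : Type} [Fintype Yo] [DecidableEq Yo] (m : Model27 fr Yo)

/-! ### Elementary facts about the instance -/

/-- `a > 0`. [cite: Balaban1982Higgs1, (2.15) p. 609] -/
private theorem ha' : 0 < m.a := lt_of_lt_of_le fr.ha m.ha1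

/-- `a_k > 0`. [cite: Balaban1982Higgs1, (2.15) p. 609] -/
private theorem hak : 0 < B1.aSeq m.a ((fr.ℓ : ℝ) + 1) m.k := B1.aSeq_pos m.ha' fr.hL m.hk

/-- `a_k ≤ a₊`. [cite: Balaban1982Higgs1, (2.15) p. 609] -/
private theorem hakle : B1.aSeq m.a ((fr.ℓ : ℝ) + 1) m.k ≤ fr.aplus := (B1.aSeq_le m.ha' fr.hL m.k m.hk).trans m.ha2

/-- `a_k ≥ a₋(1 − L⁻²)`. [cite: Balaban1982Higgs1, (2.15) p. 609] -/
theorem hakge : fr.aminC ≤ B1.aSeq m.a ((fr.ℓ : ℝ) + 1) m.k := by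
  refine le_trans ?_ (aSeq_ge m.ha' fr.hL m.hk)
  obtain ⟨hr0, hr1⟩ := r_bounds' fr.hL
  unfold Frame27.aminC
  exact mul_le_mul_of_nonneg_right m.ha1 (by linarith)

/-- `n = L^k ≥ 1`. [cite: Balaban1982Higgs2, p. 570 «η = L^{−k}»] -/
private theorem hn : 1 ≤ (fr.ℓ + 1) ^ m.k := Nat.one_le_pow _ _ (Nat.succ_pos _)

/-- the unit box has positive sides. [cite: Balaban1982Higgs2, (2.113) p. 581] -/
theorem hM : ∀ i, 1 ≤ M2 fr.ℓ m.M' i := fun i =>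
  Nat.one_le_iff_ne_zero.2 (Nat.mul_ne_zero (Nat.succ_ne_zero _) (Nat.one_le_iff_ne_zero.1 (m.hM' i)))

/-! ### The zero-field matrix of the instance (B4BoxCov237) -/

/-- invertibility and decay of `C^{(k)}(□) = X0⁻¹` on the instance's window. [cite: Balaban1983RegularityDecay, (2.37) p. 582] -/
theorem X0_spec : m.X0 * m.X0⁻¹ = 1 ∧ ∀ y y' : ↥(boxDom (M2 fr.ℓ m.M')),
    |m.X0⁻¹ y y'| ≤ fr.cC * Real.exp (-(fr.δC * supNorm (y.1 - y'.1))) :=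
  fr.covConsts_spec.2.2 _ m.hn _ _ _ m.hakge m.hakle m.hm1 m.hm2 le_rfl le_rfl m.M' m.hM'

/-- `X0` is invertible. [cite: Balaban1983RegularityDecay, (1.15) p. 574] -/
theorem X0_isUnit : IsUnit m.X0.det := Matrix.isUnit_det_of_right_inverse m.X0_spec.1

/-- the row sums of `|C^{(k)}(□)|` are at most `c_CS(δ_C) = CC0`. [cite: Balaban1982Higgs1, Prop. 2.3 (2.36) p. 611] -/
theorem X0_rowabs_le (y : ↥(boxDom (M2 fr.ℓ m.M'))) : ∑ y', |m.X0⁻¹ y y'| ≤ fr.CC0 := by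
  calc ∑ y', |m.X0⁻¹ y y'| ≤ ∑ y' : ↥(boxDom (M2 fr.ℓ m.M')),
        fr.cC * Real.exp (-(fr.δC * supNorm (y.1 - y'.1))) := Finset.sum_le_sum fun y' _ => m.X0_spec.2 y y'
    _ = fr.cC * ∑ y' : ↥(boxDom (M2 fr.ℓ m.M')), Real.exp (-(fr.δC * supNorm (y.1 - y'.1))) := by
        rw [Finset.mul_sum]
    _ ≤ fr.cC * Frame27.SS d fr.δC := mul_le_mul_of_nonneg_left (sum_exp_supNorm_le fr.δC_pos y) fr.cC_pos.le

/-! ### The fields `□′₁ψ` and `ψ′` -/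

/-- `□′₁ψ = ψ` on `□′₁`. [cite: Balaban1982Higgs2, p. 572] -/
theorem fld_Ψ_of_mem {z : ↥(boxDom m.M')} (hz : z ∈ m.sq1) : fld m.Ψ z = m.ψ z := fld_boxOneField_of_mem m.ψ hz

/-- `□′₁ψ = 0` off `□′₁`. [cite: Balaban1982Higgs2, p. 572] -/
theorem fld_Ψ_of_not_mem {z : ↥(boxDom m.M')} (hz : z ∉ m.sq1) : fld m.Ψ z = 0 := fld_boxOneField_of_not_mem m.ψ hz

/-- `‖□′₁ψ‖_∞ ≤ t_ψ·q` under the restrictions. [cite: Balaban1982Higgs2, (2.16) p. 560] -/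
theorem supN_Ψ_le (hR : m.Restr) : supN m.Ψ ≤ m.tψ * m.q := by
  refine supN_le (mul_nonneg m.tψ_nonneg m.q_nonneg) fun z => ?_
  by_cases hz : z ∈ m.sq1
  · rw [m.fld_Ψ_of_mem hz, ← m.ψΩ_inc z hz]; exact hR.bound _ (m.inc_mem z hz)
  · rw [m.fld_Ψ_of_not_mem hz, siteNorm_zero]; exact mul_nonneg m.tψ_nonneg m.q_nonneg

/-- `ψ′(z) = U(B₀(Γ_{z,·}))ᵀ□′₁ψ(z)`. [cite: Balaban1982Higgs2, p. 573] -/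
theorem fld_ψ' (z : ↥(boxDom m.M')) :
    fld m.ψ' z = (gaugeU d fr.F m.κ fr.ℓ m.k (M2 fr.ℓ m.M') m.A₀ (m.emb' z))ᵀ *ᵥ fld m.Ψ z := by
  dsimp only [ψ']
  rw [B4GaugeCovariance.blockDiag_transpose, fld_blockDiag_mulVec]
  rfl

/-- `|ψ′(z)| = |□′₁ψ(z)|`. [cite: Balaban1982Higgs2, p. 573] -/
theorem siteNorm_fld_ψ' (z : ↥(boxDom m.M')) : siteNorm (fld m.ψ' z) = siteNorm (fld m.Ψ z) :=
  siteNorm_fld_blockDiag_gaugeU_transpose fr.F m.κ fr.ℓ m.k _ m.A₀ m.emb' m.Ψ z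

/-- `‖ψ′‖_∞ ≤ t_ψ·q`. [cite: Balaban1982Higgs2, (2.16) p. 560] -/
theorem supN_ψ'_le (hR : m.Restr) : supN m.ψ' ≤ m.tψ * m.q := by
  dsimp only [ψ']
  rw [supN_blockDiag_gaugeU_transpose]
  exact m.supN_Ψ_le hR

/-! ### `C^{(k)}(□,B₀)`: gauge form and sup-operator bound -/

/-- `C^{(k)}(□,B₀) = ℋ(C^{(k)}(□) ⊗ 1)ℋᵀ` for the instance. [cite: Balaban1982Higgs2, (2.73) p. 573] -/
theorem C0_eq : m.C0 = blockDiag (gaugeU d fr.F m.κ fr.ℓ m.k (M2 fr.ℓ m.M') m.A₀ ∘ m.emb)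
    * (m.X0⁻¹ ⊗ₖ (1 : Matrix ι ι ℝ)) * (blockDiag (gaugeU d fr.F m.κ fr.ℓ m.k (M2 fr.ℓ m.M') m.A₀ ∘ m.emb))ᵀ :=
  Cop_constBond fr.F m.κ fr.hℓ m.hk fr.a₂ m.ha' m.hm1 m.hM' m.hend m.hend' m.A₀ m.X0_spec.1

/-- **`‖C^{(k)}(□,B₀)‖_{∞→∞} ≤ CC0`**. [cite: Balaban1982Higgs1, Prop. 2.3 (2.36) p. 611] -/
theorem C0_bound (v : ↥(boxDom (M2 fr.ℓ m.M')) × ι → ℝ) : supN (m.C0 *ᵥ v) ≤ fr.CC0 * supN v := by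
  rw [m.C0_eq]
  exact supN_conj_kron_le fr.F m.κ fr.ℓ m.k _ m.A₀ m.emb _ fr.CC0_nonneg m.X0_rowabs_le v

/-- `C^{(k)}(□,B₀)·(Δ^{(k)}(□,B₀) + aL⁻²P(B₀)) = 1`. [cite: Balaban1983RegularityDecay, (1.13) p. 573] -/
theorem C0_mul_M0 : m.C0 * Mop d fr.F m.κ fr.ℓ m.k fr.a₂ m.a m.m2 m.M' m.emb m.Γ m.emb' m.Γ' m.A0b = 1 :=
  Matrix.nonsing_inv_mul _ (isUnit_det_Mop_constBond fr.F m.κ fr.hℓ m.hk fr.a₂ m.ha' m.hm1 m.hM' m.hend m.hend' m.A₀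
    m.X0_spec.1)

/-- `(Δ^{(k)}(□,B̃) + aL⁻²P(B̃))·C^{(k)}(□,B̃) = 1`. [cite: Balaban1983RegularityDecay, (1.13) p. 573] -/
theorem Mt_mul_Ct : Mop d fr.F m.κ fr.ℓ m.k fr.a₂ m.a m.m2 m.M' m.emb m.Γ m.emb' m.Γ' m.At * m.Ct = 1 :=
  Matrix.mul_nonsing_inv _ m.hunitM

/-! ### The expansion in `B′` -/

/-- `(a_kG_kQ_k^*)v = a_k·G_k(Q_k^*v)`. [cite: Balaban1982Higgs2, (2.68) p. 572] -/
theorem gOp_mulVec (A : ↥(Box d fr.ℓ m.k (M2 fr.ℓ m.M')) → ↥(Box d fr.ℓ m.k (M2 fr.ℓ m.M')) → ℝ)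
    (v : ↥(boxDom (M2 fr.ℓ m.M')) × ι → ℝ) :
    gOp d fr.F m.κ fr.ℓ m.k m.a m.m2 (M2 fr.ℓ m.M') m.emb m.Γ A *ᵥ v
      = B1.aSeq m.a ((fr.ℓ : ℝ) + 1) m.k • (greenA d fr.F m.κ fr.ℓ m.k m.a m.m2 (M2 fr.ℓ m.M') m.emb m.Γ A
          *ᵥ ((avgA d fr.F m.κ fr.ℓ m.k (M2 fr.ℓ m.M') m.emb m.Γ A)ᵀ *ᵥ v)) := by
  dsimp only [gOp]
  rw [smul_mulVec, ← mulVec_mulVec]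

/-- **PROPOSITION I.2.2, DERIVATIVES, IN THE `D_{B₀}` CONVENTION** (operator form): `Σ_μ‖D_{B₀,μ}(a_kG̃Q̃^*v)‖_∞ ≤
(d+1)c_I(1 + ℓ₁θ)‖v‖_∞`. [cite: Balaban1982Higgs2, (2.68) p. 572 «Proposition I.2.2»] -/
theorem sumD_le (v : ↥(boxDom (M2 fr.ℓ m.M')) × ι → ℝ) :
    ∑ μ, supN (derivA0 d fr.F m.κ fr.ℓ m.k (M2 fr.ℓ m.M') m.A₀ μ
      *ᵥ (B1.aSeq m.a ((fr.ℓ : ℝ) + 1) m.k • (greenA d fr.F m.κ fr.ℓ m.k m.a m.m2 (M2 fr.ℓ m.M') m.emb m.Γ m.At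
        *ᵥ ((avgA d fr.F m.κ fr.ℓ m.k (M2 fr.ℓ m.M') m.emb m.Γ m.At)ᵀ *ᵥ v))))
      ≤ ((d : ℝ) + 1) * (fr.cI + fr.ℓ₁ * m.θ * fr.cI) * supN v := by
  set g := B1.aSeq m.a ((fr.ℓ : ℝ) + 1) m.k • (greenA d fr.F m.κ fr.ℓ m.k m.a m.m2 (M2 fr.ℓ m.M') m.emb m.Γ m.At
        *ᵥ ((avgA d fr.F m.κ fr.ℓ m.k (M2 fr.ℓ m.M') m.emb m.Γ m.At)ᵀ *ᵥ v)) with hg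
  have hgs : supN g ≤ fr.cI * supN v := m.sup_g v
  have hμ : ∀ μ, supN (derivA0 d fr.F m.κ fr.ℓ m.k (M2 fr.ℓ m.M') m.A₀ μ *ᵥ g) ≤ (fr.cI + fr.ℓ₁ * m.θ * fr.cI) * supN v := by
    intro μ
    have hsub := covDeriv_sub_supN_le_nbrs fr.F fr.hℓ₁ fr.hLip m.κ m.hn (constBond m.A₀ Subtype.val)
      (A' := m.A') m.hθ m.hA' μ g
    have hid : derivA0 d fr.F m.κ fr.ℓ m.k (M2 fr.ℓ m.M') m.A₀ μ *ᵥ g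
        = derivA d fr.F m.κ fr.ℓ m.k (M2 fr.ℓ m.M') m.At μ *ᵥ g
          + -((derivA d fr.F m.κ fr.ℓ m.k (M2 fr.ℓ m.M') m.At μ - derivA0 d fr.F m.κ fr.ℓ m.k (M2 fr.ℓ m.M') m.A₀ μ)
              *ᵥ g) := by
      rw [sub_mulVec]; abel
    rw [hid]
    refine (supN_add_le _ _).trans ?_
    rw [supN_neg]
    have h1 : supN (derivA d fr.F m.κ fr.ℓ m.k (M2 fr.ℓ m.M') m.At μ *ᵥ g) ≤ fr.cI * supN v := m.sup_Dg μ v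
    have h2 : fr.ℓ₁ * m.θ * supN g ≤ fr.ℓ₁ * m.θ * (fr.cI * supN v) :=
      mul_le_mul_of_nonneg_left hgs (mul_nonneg fr.hℓ₁ m.hθ)
    calc supN (derivA d fr.F m.κ fr.ℓ m.k (M2 fr.ℓ m.M') m.At μ *ᵥ g)
          + supN ((derivA d fr.F m.κ fr.ℓ m.k (M2 fr.ℓ m.M') m.At μ
              - derivA0 d fr.F m.κ fr.ℓ m.k (M2 fr.ℓ m.M') m.A₀ μ) *ᵥ g)
        ≤ fr.cI * supN v + fr.ℓ₁ * m.θ * (fr.cI * supN v) := add_le_add h1 (hsub.trans h2)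
      _ = (fr.cI + fr.ℓ₁ * m.θ * fr.cI) * supN v := by ring
  calc ∑ μ, supN (derivA0 d fr.F m.κ fr.ℓ m.k (M2 fr.ℓ m.M') m.A₀ μ *ᵥ g)
      ≤ ∑ _μ : Fin (d + 1), (fr.cI + fr.ℓ₁ * m.θ * fr.cI) * supN v := Finset.sum_le_sum fun μ _ => hμ μ
    _ = ((d : ℝ) + 1) * (fr.cI + fr.ℓ₁ * m.θ * fr.cI) * supN v := by
        rw [Finset.sum_const, Finset.card_univ, Fintype.card_fin, nsmul_eq_mul]; push_cast; ring

/-- **THE (2.68) REMAINDER AS AN OPERATOR**: `‖a_kG_k(□,B̃)Q_k^*(B̃) − a_kG_k(□,B₀)Q_k^*(B₀)‖_{∞→∞} ≤ ρ`.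
[cite: Balaban1982Higgs2, (2.68) p. 572] -/
theorem rem_op (v : ↥(boxDom (M2 fr.ℓ m.M')) × ι → ℝ) :
    supN (gOp d fr.F m.κ fr.ℓ m.k m.a m.m2 (M2 fr.ℓ m.M') m.emb m.Γ m.At *ᵥ v
      - gOp d fr.F m.κ fr.ℓ m.k m.a m.m2 (M2 fr.ℓ m.M') m.emb m.Γ m.A0b *ᵥ v)
      ≤ fr.rho m.k m.a m.θ m.τ * supN v := by
  have h := fr.c68_spec.2 m.κ m.k m.hk m.a m.m2 m.ha1 m.ha2 m.hm1 m.hm2 (M2 fr.ℓ m.M') m.hM m.emb m.Γ m.hend m.A₀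
    m.A' m.θ m.τ m.hunit m.hθ m.hA' m.hτ m.hτA v
  rw [m.gOp_mulVec, m.gOp_mulVec]
  refine h.trans ?_
  have hc := fr.c68_pos.le
  have hv := supN_nonneg v
  have hθ := m.hθ; have hτ := m.hτ; have hℓ₁ := fr.hℓ₁; have hcI := fr.cI_nonneg; have hak := m.hak.le
  have t2 := mul_le_mul_of_nonneg_left (m.sumD_le v) (by positivity : 0 ≤ fr.c68 * (((d : ℝ) + 1) * fr.ℓ₁ * m.θ))
  have t3 := mul_le_mul_of_nonneg_left (m.sup_g v)
    (by positivity : 0 ≤ fr.c68 * (((d : ℝ) + 1) * fr.ℓ₁ ^ 2 * m.θ ^ 2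
      + B1.aSeq m.a ((fr.ℓ : ℝ) + 1) m.k * (fr.ℓ₁ * m.τ * (2 + fr.ℓ₁ * m.τ)) + ((d : ℝ) + 1) * fr.ℓ₁ * m.θ))
  unfold Frame27.rho
  nlinarith

/-- **`‖(Δ^{(k)} + aL⁻²P)(B̃) − (Δ^{(k)} + aL⁻²P)(B₀)‖_{∞→∞} ≤ μ`** for the instance.
[cite: Balaban1982Higgs2, (2.68), (2.73) pp. 572–573] -/
theorem M_sub_op (v : ↥(boxDom (M2 fr.ℓ m.M')) × ι → ℝ) :
    supN ((Mop d fr.F m.κ fr.ℓ m.k fr.a₂ m.a m.m2 m.M' m.emb m.Γ m.emb' m.Γ' m.At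
      - Mop d fr.F m.κ fr.ℓ m.k fr.a₂ m.a m.m2 m.M' m.emb m.Γ m.emb' m.Γ' m.A0b) *ᵥ v)
      ≤ fr.mu m.k m.a m.θ m.τ m.τ' * supN v := by
  have h := Mop_sub_bound fr.F fr.hℓ₁ fr.hLip m.κ fr.hℓ m.hk fr.ha₂.le m.ha' m.m2 m.M' m.emb m.Γ m.emb' m.Γ' m.A0b m.A'
    m.hτ m.hτ' fr.cI_nonneg (fr.rho_nonneg m.hk m.ha1 m.hθ m.hτ) m.hτA m.hτA'
    (fun w => by rw [gOp_mulVec]; exact m.sup_g w) m.rem_op v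
  exact h

/-- **THE RESOLVENT STEP FOR THE INSTANCE**: `‖C^{(k)}(□,B̃)‖ ≤ 2CC0` and `‖C^{(k)}(□,B̃) − C^{(k)}(□,B₀)‖ ≤ 2CC0²μ`.
[cite: Balaban1982Higgs2, (2.68) p. 572 «Using the expansion formula (I.3.44)»] -/
theorem Ct_bounds : (∀ v, supN (m.Ct *ᵥ v) ≤ 2 * fr.CC0 * supN v) ∧
    ∀ v, supN ((m.Ct - m.C0) *ᵥ v) ≤ 2 * fr.CC0 ^ 2 * fr.mu m.k m.a m.θ m.τ m.τ' * supN v :=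
  expansion_bound _ _ m.C0 m.Ct m.C0_mul_M0 m.Mt_mul_Ct fr.CC0_nonneg (fr.mu_nonneg m.hk m.ha1 m.hθ m.hτ m.hτ')
    m.C0_bound m.M_sub_op m.hsmall

end Model27

end Estimates

/-! ## §5 The constants of the bound and the scale bookkeeping -/

section Constants

variable {d : ℕ}

omit [Fintype ι] [DecidableEq ι] in
/-- the elementary scale step: `β·t ≤ K ⇒ A·β·(t·q) ≤ A·K·q` (`A, q ≥ 0`). [cite: Balaban1982Higgs2, (2.113) p. 581 «O(p(L^kε))»] -/
theorem scale_le' {A β t K q : ℝ} (hA : 0 ≤ A) (hq : 0 ≤ q) (h : β * t ≤ K) :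
    A * β * (t * q) ≤ A * K * q := by
  have := mul_le_mul_of_nonneg_left h (mul_nonneg hA hq)
  nlinarith

namespace Frame27

variable (fr : Frame27 ι d)

/-- the scale-free bound `ρ_K ≥ ρ·t_ψ` («O(p r)·|ψ| = O(p)»-bookkeeping of the (2.68) remainder for (2.113)).
[cite: Balaban1982Higgs2, (2.68) p. 572, (2.113) p. 581] -/
def rhoK : ℝ :=
  fr.c68 * (fr.aplus * fr.ℓ₁ * fr.Kτ + ((d : ℝ) + 1) * fr.ℓ₁ * fr.Kθ * (((d : ℝ) + 1) * (fr.cI + fr.ℓ₁ * fr.cI))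
    + (((d : ℝ) + 1) * fr.ℓ₁ ^ 2 * fr.Kθ + fr.aplus * fr.ℓ₁ * fr.Kτ * (2 + fr.ℓ₁) + ((d : ℝ) + 1) * fr.ℓ₁ * fr.Kθ)
      * fr.cI)

/-- the scale-free bound `μ_K ≥ μ·t_ψ`. [cite: Balaban1982Higgs2, (2.113) p. 581] -/
def muK : ℝ :=
  fr.aplus * (fr.ℓ₁ * fr.Kτ * fr.cI) + fr.aplus * fr.rhoK + 2 * (fr.a₂ / ((fr.ℓ : ℝ) + 1) ^ 2) * (fr.ℓ₁ * fr.Kτ')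

/-- the coefficient of `q` from the expansion in `B′` (`aL⁻²(2CC0²μ_K + CC0ℓ₁K_{τ′})`). [cite: Balaban1982Higgs2, (2.113) p. 581] -/
def CE : ℝ := fr.a₂ / ((fr.ℓ : ℝ) + 1) ^ 2 * (2 * fr.CC0 ^ 2 * fr.muK + fr.CC0 * fr.ℓ₁ * fr.Kτ')

/-- the coefficient of `q` from the zero-field main term (Lemma 2.5's idea: decay of `C^{(k)}(□)`, the Lipschitz bound on
`ψ′`, the far part, and `|aL⁻²C^{(k)}1 − 1| = O(μ₀²(L^kε)²)`). [cite: Balaban1982Higgs2, (2.82)–(2.85) pp. 574–575] -/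
def CZ : ℝ :=
  fr.a₂ / ((fr.ℓ : ℝ) + 1) ^ 2 * fr.cC
      * (fr.r₁ * SS d fr.δC + fr.r₂ / ((fr.ℓ : ℝ) + 1) * (2 / fr.δC * SS d (fr.δC / 2)) + fr.K₂ * SS d (fr.δC / 2))
    + ((fr.ℓ : ℝ) + 1) ^ 2 / fr.a₂ * fr.Km

/-- **THE CONSTANT OF (2.113) FOR THE FAMILY** (coefficient of `q`). [cite: Balaban1982Higgs2, (2.113) p. 581] -/
def C27 : ℝ := fr.cO * fr.SO * (fr.K₅ + fr.K₄) + fr.CE + fr.CZ + fr.ℓ₁ * fr.Kτ'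

/-- `ρ_K ≥ 0`. [cite: Balaban1982Higgs2, (2.113) p. 581] -/
theorem rhoK_nonneg : 0 ≤ fr.rhoK := by
  have := fr.c68_pos; have := fr.aplus_pos; have := fr.hℓ₁; have := fr.Kτ_nonneg; have := fr.Kθ_nonneg
  have := fr.cI_nonneg
  unfold rhoK; positivity

/-- `μ_K ≥ 0`. [cite: Balaban1982Higgs2, (2.113) p. 581] -/
theorem muK_nonneg : 0 ≤ fr.muK := by
  have := fr.rhoK_nonneg; have := fr.aplus_pos; have := fr.hℓ₁; have := fr.Kτ_nonneg; have := fr.Kτ'_nonneg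
  have := fr.cI_nonneg; have := fr.ha₂
  unfold muK; positivity

/-- `C27 ≥ 0`. [cite: Balaban1982Higgs2, (2.113) p. 581] -/
theorem C27_nonneg : 0 ≤ fr.C27 := by
  have := fr.muK_nonneg; have := fr.aplus_pos; have := fr.hℓ₁; have := fr.Kτ'_nonneg; have := fr.K₂_nonneg
  have := fr.K₄_nonneg; have := fr.K₅_nonneg; have := fr.cO_nonneg; have := fr.SO_nonneg; have := fr.ha₂
  have := fr.CC0_nonneg; have := fr.cC_pos; have := fr.r₁_nonneg; have := fr.r₂_nonneg; have := fr.Km_nonneg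
  have := fr.δC_pos; have := SS_nonneg d fr.δC_pos; have := SS_nonneg d (half_pos fr.δC_pos)
  unfold C27 CE CZ; positivity

end Frame27

namespace Model27

variable {fr : Frame27 ι d} {Yo : Type} [Fintype Yo] [DecidableEq Yo] (m : Model27 fr Yo)

/-- **THE SCALE BOOKKEEPING OF `ρ`**: `ρ·t_ψ ≤ ρ_K`. [cite: Balaban1982Higgs2, (2.113) p. 581] -/
theorem rho_scale : fr.rho m.k m.a m.θ m.τ * m.tψ ≤ fr.rhoK := by
  have ht := m.tψ_nonneg; have hℓ₁ := fr.hℓ₁; have hθ := m.hθ; have hτ := m.hτ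
  have hcI := fr.cI_nonneg; have hKθ := fr.Kθ_nonneg; have hKτ := fr.Kτ_nonneg
  have hap := fr.aplus_pos.le; have hak := m.hak.le; have hakle := m.hakle; have hc := fr.c68_pos.le
  set ak := B1.aSeq m.a ((fr.ℓ : ℝ) + 1) m.k with hakdef
  have u1 : m.θ * m.tψ ≤ fr.Kθ := m.θ_scale
  have u2 : m.τ * m.tψ ≤ fr.Kτ := m.τ_scale
  have u3 : m.θ ^ 2 * m.tψ ≤ fr.Kθ := by
    calc m.θ ^ 2 * m.tψ = m.θ * (m.θ * m.tψ) := by ring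
      _ ≤ 1 * fr.Kθ := mul_le_mul m.hθ1 u1 (mul_nonneg hθ ht) zero_le_one
      _ = fr.Kθ := one_mul _
  -- term by term, with `q := 1`
  have T1 : fr.c68 * (ak * (fr.ℓ₁ * m.τ)) * m.tψ ≤ fr.c68 * (fr.aplus * fr.ℓ₁ * fr.Kτ) := by
    calc fr.c68 * (ak * (fr.ℓ₁ * m.τ)) * m.tψ = (fr.c68 * ak * fr.ℓ₁) * m.τ * (m.tψ * 1) := by ring
      _ ≤ (fr.c68 * ak * fr.ℓ₁) * fr.Kτ * 1 := scale_le' (by positivity) zero_le_one u2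
      _ ≤ (fr.c68 * fr.aplus * fr.ℓ₁) * fr.Kτ * 1 := by
          have : fr.c68 * ak * fr.ℓ₁ ≤ fr.c68 * fr.aplus * fr.ℓ₁ :=
            mul_le_mul_of_nonneg_right (mul_le_mul_of_nonneg_left hakle hc) hℓ₁
          exact mul_le_mul_of_nonneg_right (mul_le_mul_of_nonneg_right this hKτ) zero_le_one
      _ = fr.c68 * (fr.aplus * fr.ℓ₁ * fr.Kτ) := by ring
  have T2 : fr.c68 * (((d : ℝ) + 1) * fr.ℓ₁ * m.θ) * (((d : ℝ) + 1) * (fr.cI + fr.ℓ₁ * m.θ * fr.cI)) * m.tψ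
      ≤ fr.c68 * (((d : ℝ) + 1) * fr.ℓ₁ * fr.Kθ * (((d : ℝ) + 1) * (fr.cI + fr.ℓ₁ * fr.cI))) := by
    have hin : fr.cI + fr.ℓ₁ * m.θ * fr.cI ≤ fr.cI + fr.ℓ₁ * fr.cI := by
      have : fr.ℓ₁ * m.θ * fr.cI ≤ fr.ℓ₁ * 1 * fr.cI :=
        mul_le_mul_of_nonneg_right (mul_le_mul_of_nonneg_left m.hθ1 hℓ₁) hcI
      linarith
    calc fr.c68 * (((d : ℝ) + 1) * fr.ℓ₁ * m.θ) * (((d : ℝ) + 1) * (fr.cI + fr.ℓ₁ * m.θ * fr.cI)) * m.tψ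
        ≤ fr.c68 * (((d : ℝ) + 1) * fr.ℓ₁ * m.θ) * (((d : ℝ) + 1) * (fr.cI + fr.ℓ₁ * fr.cI)) * m.tψ := by
          refine mul_le_mul_of_nonneg_right (mul_le_mul_of_nonneg_left (mul_le_mul_of_nonneg_left hin (by positivity))
            (by positivity)) ht
      _ = (fr.c68 * (((d : ℝ) + 1) * fr.ℓ₁) * (((d : ℝ) + 1) * (fr.cI + fr.ℓ₁ * fr.cI))) * m.θ * (m.tψ * 1) := by ring
      _ ≤ (fr.c68 * (((d : ℝ) + 1) * fr.ℓ₁) * (((d : ℝ) + 1) * (fr.cI + fr.ℓ₁ * fr.cI))) * fr.Kθ * 1 :=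
          scale_le' (by positivity) zero_le_one u1
      _ = _ := by ring
  have T3 : fr.c68 * (((d : ℝ) + 1) * fr.ℓ₁ ^ 2 * m.θ ^ 2 + ak * (fr.ℓ₁ * m.τ * (2 + fr.ℓ₁ * m.τ))
        + ((d : ℝ) + 1) * fr.ℓ₁ * m.θ) * fr.cI * m.tψ
      ≤ fr.c68 * ((((d : ℝ) + 1) * fr.ℓ₁ ^ 2 * fr.Kθ + fr.aplus * fr.ℓ₁ * fr.Kτ * (2 + fr.ℓ₁)
        + ((d : ℝ) + 1) * fr.ℓ₁ * fr.Kθ) * fr.cI) := by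
    have s1 : ((d : ℝ) + 1) * fr.ℓ₁ ^ 2 * m.θ ^ 2 * (m.tψ * 1) ≤ ((d : ℝ) + 1) * fr.ℓ₁ ^ 2 * fr.Kθ * 1 :=
      scale_le' (by positivity) zero_le_one u3
    have s2 : ak * (fr.ℓ₁ * m.τ * (2 + fr.ℓ₁ * m.τ)) * (m.tψ * 1) ≤ fr.aplus * fr.ℓ₁ * fr.Kτ * (2 + fr.ℓ₁) * 1 := by
      have h22 : 2 + fr.ℓ₁ * m.τ ≤ 2 + fr.ℓ₁ := by nlinarith [m.hτ1]
      calc ak * (fr.ℓ₁ * m.τ * (2 + fr.ℓ₁ * m.τ)) * (m.tψ * 1)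
          = (ak * fr.ℓ₁ * (2 + fr.ℓ₁ * m.τ)) * m.τ * (m.tψ * 1) := by ring
        _ ≤ (ak * fr.ℓ₁ * (2 + fr.ℓ₁ * m.τ)) * fr.Kτ * 1 := scale_le' (by positivity) zero_le_one u2
        _ ≤ (fr.aplus * fr.ℓ₁ * (2 + fr.ℓ₁)) * fr.Kτ * 1 := by
            have : ak * fr.ℓ₁ * (2 + fr.ℓ₁ * m.τ) ≤ fr.aplus * fr.ℓ₁ * (2 + fr.ℓ₁) :=
              mul_le_mul (mul_le_mul_of_nonneg_right hakle hℓ₁) h22 (by positivity) (by positivity)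
            exact mul_le_mul_of_nonneg_right (mul_le_mul_of_nonneg_right this hKτ) zero_le_one
        _ = _ := by ring
    have s3 : ((d : ℝ) + 1) * fr.ℓ₁ * m.θ * (m.tψ * 1) ≤ ((d : ℝ) + 1) * fr.ℓ₁ * fr.Kθ * 1 :=
      scale_le' (by positivity) zero_le_one u1
    have h0 := add_le_add (add_le_add s1 s2) s3
    have := mul_le_mul_of_nonneg_left h0 (mul_nonneg hc hcI)
    nlinarith
  unfold Frame27.rho Frame27.rhoK
  nlinarith

/-- **THE SCALE BOOKKEEPING OF `μ`**: `μ·t_ψ ≤ μ_K`. [cite: Balaban1982Higgs2, (2.113) p. 581] -/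
theorem mu_scale : fr.mu m.k m.a m.θ m.τ m.τ' * m.tψ ≤ fr.muK := by
  have ht := m.tψ_nonneg; have hℓ₁ := fr.hℓ₁; have hτ := m.hτ; have hτ' := m.hτ'
  have hcI := fr.cI_nonneg; have hKτ := fr.Kτ_nonneg
  have hap := fr.aplus_pos.le; have hak := m.hak.le; have hakle := m.hakle; have ha₂ := fr.ha₂.le
  have hρ := fr.rho_nonneg m.hk m.ha1 m.hθ m.hτ
  have hρs := m.rho_scale
  set ak := B1.aSeq m.a ((fr.ℓ : ℝ) + 1) m.k with hakdef
  have T1 : ak * (fr.ℓ₁ * m.τ * fr.cI) * m.tψ ≤ fr.aplus * (fr.ℓ₁ * fr.Kτ * fr.cI) := by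
    calc ak * (fr.ℓ₁ * m.τ * fr.cI) * m.tψ = (ak * fr.ℓ₁ * fr.cI) * m.τ * (m.tψ * 1) := by ring
      _ ≤ (ak * fr.ℓ₁ * fr.cI) * fr.Kτ * 1 := scale_le' (by positivity) zero_le_one m.τ_scale
      _ ≤ (fr.aplus * fr.ℓ₁ * fr.cI) * fr.Kτ * 1 := by
          have : ak * fr.ℓ₁ * fr.cI ≤ fr.aplus * fr.ℓ₁ * fr.cI :=
            mul_le_mul_of_nonneg_right (mul_le_mul_of_nonneg_right hakle hℓ₁) hcI
          exact mul_le_mul_of_nonneg_right (mul_le_mul_of_nonneg_right this hKτ) zero_le_one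
      _ = _ := by ring
  have T2 : ak * fr.rho m.k m.a m.θ m.τ * m.tψ ≤ fr.aplus * fr.rhoK := by
    calc ak * fr.rho m.k m.a m.θ m.τ * m.tψ = ak * (fr.rho m.k m.a m.θ m.τ * m.tψ) := by ring
      _ ≤ fr.aplus * fr.rhoK := mul_le_mul hakle hρs (mul_nonneg hρ ht) hap
  have T3 : 2 * (fr.a₂ / ((fr.ℓ : ℝ) + 1) ^ 2) * (fr.ℓ₁ * m.τ') * m.tψ
      ≤ 2 * (fr.a₂ / ((fr.ℓ : ℝ) + 1) ^ 2) * (fr.ℓ₁ * fr.Kτ') := by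
    calc 2 * (fr.a₂ / ((fr.ℓ : ℝ) + 1) ^ 2) * (fr.ℓ₁ * m.τ') * m.tψ
        = (2 * (fr.a₂ / ((fr.ℓ : ℝ) + 1) ^ 2) * fr.ℓ₁) * m.τ' * (m.tψ * 1) := by ring
      _ ≤ (2 * (fr.a₂ / ((fr.ℓ : ℝ) + 1) ^ 2) * fr.ℓ₁) * fr.Kτ' * 1 := scale_le' (by positivity) zero_le_one m.τ'_scale
      _ = _ := by ring
  unfold Frame27.mu Frame27.muK
  nlinarith

end Model27

end Constants

/-! ## §6 (2.113) at a unit site of `B(z₀)`: localization, expansion, gauge, zero-field main term, assembly -/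

section Final

variable {d : ℕ}

namespace Model27

variable {fr : Frame27 ι d} {Yo : Type} [Fintype Yo] [DecidableEq Yo] (m : Model27 fr Yo)

/-! ### (E) the expansion in `B′ = B̃ − B₀` -/

/-- **`‖aL⁻²C^{(k)}(□,B̃)Q^*(B̃)□′₁ψ − aL⁻²C^{(k)}(□,B₀)Q^*(B₀)□′₁ψ‖_∞ ≤ C_E·q`** (the analogue of the (2.68) remainder for
the covariance: resolvent step + transporter differences, then the scale products). [cite: Balaban1982Higgs2, (2.68) p. 572, (2.113) p. 581] -/
theorem obj_sub_obj0_le (hR : m.Restr) : supN (m.obj - m.obj0) ≤ fr.CE * m.q := by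
  have hq := m.q_nonneg; have ht := m.tψ_nonneg; have hℓ₁ := fr.hℓ₁; have hτ' := m.hτ'
  have hCC := fr.CC0_nonneg; have hμ := fr.mu_nonneg m.hk m.ha1 m.hθ m.hτ m.hτ'
  have hc : 0 ≤ fr.a₂ / ((fr.ℓ : ℝ) + 1) ^ 2 := by have := fr.ha₂; positivity
  set c := fr.a₂ / ((fr.ℓ : ℝ) + 1) ^ 2 with hcdef
  set Qt := avgU d fr.F m.κ fr.ℓ m.k m.M' m.emb' m.Γ' m.At with hQt
  set Q0 := avgU d fr.F m.κ fr.ℓ m.k m.M' m.emb' m.Γ' m.A0b with hQ0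
  have hsplit : m.obj - m.obj0 = c • ((m.Ct - m.C0) *ᵥ (Qtᵀ *ᵥ m.Ψ) + m.C0 *ᵥ ((Qtᵀ - Q0ᵀ) *ᵥ m.Ψ)) := by
    dsimp only [obj, obj0]
    rw [← hcdef, ← hQt, ← hQ0, smul_mulVec, smul_mulVec, ← mulVec_mulVec, ← mulVec_mulVec, ← smul_sub, sub_mulVec,
      sub_mulVec, mulVec_sub]
    congr 1; abel
  have hΨ := m.supN_Ψ_le hR
  have h1 : supN (Qtᵀ *ᵥ m.Ψ) ≤ m.tψ * m.q :=
    (supN_le (supN_nonneg _) fun y => avgUT_site_le fr.F m.κ fr.ℓ m.k m.M' m.emb' m.Γ' m.At m.Ψ y).trans hΨ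
  have h2 : supN ((Qtᵀ - Q0ᵀ) *ᵥ m.Ψ) ≤ fr.ℓ₁ * m.τ' * (m.tψ * m.q) :=
    (supN_le (mul_nonneg (mul_nonneg hℓ₁ hτ') (supN_nonneg _)) fun y => avgUT_sub_site_le fr.F fr.hℓ₁ fr.hLip m.κ
      fr.ℓ m.k m.M' m.emb' m.Γ' m.A0b m.A' m.hτ' m.hτA' m.Ψ y).trans (mul_le_mul_of_nonneg_left hΨ (mul_nonneg hℓ₁ hτ'))
  obtain ⟨-, hdiff⟩ := m.Ct_bounds
  have e1 : supN ((m.Ct - m.C0) *ᵥ (Qtᵀ *ᵥ m.Ψ)) ≤ 2 * fr.CC0 ^ 2 * fr.mu m.k m.a m.θ m.τ m.τ' * (m.tψ * m.q) :=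
    (hdiff _).trans (mul_le_mul_of_nonneg_left h1 (by positivity))
  have e2 : supN (m.C0 *ᵥ ((Qtᵀ - Q0ᵀ) *ᵥ m.Ψ)) ≤ fr.CC0 * (fr.ℓ₁ * m.τ' * (m.tψ * m.q)) :=
    (m.C0_bound _).trans (mul_le_mul_of_nonneg_left h2 hCC)
  rw [hsplit]
  refine (supN_smul_le _ _).trans ?_
  rw [abs_of_nonneg hc]
  refine (mul_le_mul_of_nonneg_left ((supN_add_le _ _).trans (add_le_add e1 e2)) hc).trans ?_
  -- the scale products
  have s1 : 2 * fr.CC0 ^ 2 * fr.mu m.k m.a m.θ m.τ m.τ' * (m.tψ * m.q) ≤ 2 * fr.CC0 ^ 2 * fr.muK * m.q :=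
    scale_le' (by positivity) hq m.mu_scale
  have s2 : fr.CC0 * (fr.ℓ₁ * m.τ' * (m.tψ * m.q)) ≤ fr.CC0 * fr.ℓ₁ * fr.Kτ' * m.q := by
    have := scale_le' (mul_nonneg hCC hℓ₁) hq m.τ'_scale
    nlinarith
  unfold Frame27.CE
  nlinarith

/-! ### (G) the gauge-away of `B₀` -/

/-- the straight transporter of the constant field between two points is a pure gauge. [cite: Balaban1982Higgs2, (2.72) p. 573] -/
theorem fieldLink_A0b (u v : ↥(Box d fr.ℓ m.k (M2 fr.ℓ m.M'))) :
    fieldLink fr.F m.κ m.A0b u v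
      = gaugeU d fr.F m.κ fr.ℓ m.k (M2 fr.ℓ m.M') m.A₀ u * (gaugeU d fr.F m.κ fr.ℓ m.k (M2 fr.ℓ m.M') m.A₀ v)ᵀ := by
  dsimp only [A0b, gaugeU]
  rw [fieldLink_constBond, gaugeKer_apply, Matrix.mul_one]

/-- **THE ZERO-FIELD MAIN TERM AFTER THE GAUGE**: `main′(y) = aL⁻²((C^{(k)}(□) ⊗ 1)Q^*1ψ′)(y) =
aL⁻²Σ_{y′}C^{(k)}(□; y, y′)ψ′(z(y′))`. [cite: Balaban1982Higgs2, (2.74) p. 573, (2.82) p. 574] -/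
def mainZ (y : ↥(boxDom (M2 fr.ℓ m.M'))) : ι → ℝ :=
  (fr.a₂ / ((fr.ℓ : ℝ) + 1) ^ 2)
    • fld ((m.X0⁻¹ ⊗ₖ (1 : Matrix ι ι ℝ)) *ᵥ ((avgOneU ι d fr.ℓ m.M')ᵀ *ᵥ m.ψ')) y

/-- `main′(y)` as the kernel sum `aL⁻²Σ_{y′}C^{(k)}(□; y, y′)ψ′(z(y′))`. [cite: Balaban1982Higgs2, (2.82) p. 574] -/
theorem mainZ_eq_sum (y : ↥(boxDom (M2 fr.ℓ m.M'))) :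
    m.mainZ y = (fr.a₂ / ((fr.ℓ : ℝ) + 1) ^ 2)
      • ∑ y' : ↥(boxDom (M2 fr.ℓ m.M')), m.X0⁻¹ y y' • fld m.ψ' (cSite d fr.ℓ m.M' y') := by
  simp only [mainZ, fld_kron_mulVec, fld_avgOneUT]

/-- **`aL⁻²(C^{(k)}(□,B₀)Q^*(B₀)□′₁ψ)(y) = U(B₀(Γ_{y,·}))·main′(y)`** (the (2.74)-analogue for the covariance).
[cite: Balaban1982Higgs2, (2.74) p. 573, (2.113) p. 581] -/
theorem fld_obj0 (y : ↥(boxDom (M2 fr.ℓ m.M'))) :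
    fld m.obj0 y = gaugeU d fr.F m.κ fr.ℓ m.k (M2 fr.ℓ m.M') m.A₀ (m.emb y) *ᵥ m.mainZ y := by
  set H := blockDiag (gaugeU d fr.F m.κ fr.ℓ m.k (M2 fr.ℓ m.M') m.A₀ ∘ m.emb) with hH
  set H' := blockDiag (gaugeU d fr.F m.κ fr.ℓ m.k (M2 fr.ℓ m.M') m.A₀ ∘ m.emb') with hH'
  have hHtH : Hᵀ * H = 1 := blockDiag_transpose_mul_self (fr.F.isGauge _)
  have hQ0 : avgU d fr.F m.κ fr.ℓ m.k m.M' m.emb' m.Γ' m.A0b = H' * avgOneU ι d fr.ℓ m.M' * Hᵀ :=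
    avgU_constBond fr.F m.κ fr.ℓ m.k m.M' m.hend' m.A₀
  have hprod : m.C0 * (avgU d fr.F m.κ fr.ℓ m.k m.M' m.emb' m.Γ' m.A0b)ᵀ
      = H * ((m.X0⁻¹ ⊗ₖ (1 : Matrix ι ι ℝ)) * (avgOneU ι d fr.ℓ m.M')ᵀ) * H'ᵀ := by
    rw [m.C0_eq, hQ0]
    simp only [Matrix.transpose_mul, Matrix.transpose_transpose, Matrix.mul_assoc]
    rw [← Matrix.mul_assoc Hᵀ H, hHtH, Matrix.one_mul]
  have e : m.obj0 = (fr.a₂ / ((fr.ℓ : ℝ) + 1) ^ 2)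
      • (H *ᵥ ((m.X0⁻¹ ⊗ₖ (1 : Matrix ι ι ℝ)) *ᵥ ((avgOneU ι d fr.ℓ m.M')ᵀ *ᵥ m.ψ'))) := by
    dsimp only [obj0, ψ']
    rw [hprod, smul_mulVec, ← mulVec_mulVec, ← mulVec_mulVec, ← mulVec_mulVec]
  rw [e, show ∀ (r : ℝ) (w : ↥(boxDom (M2 fr.ℓ m.M')) × ι → ℝ), fld (r • w) y = r • fld w y from fun _ _ => rfl,
    hH, fld_blockDiag_mulVec, ← mulVec_smul]
  rfl

/-! ### (Z) the zero-field estimate (Lemma 2.5's idea) -/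

/-- `ψ′(z) = U(B₀(Γ_{z₀,·}))ᵀ·[U(B₀; z₀ → z)ψ(z)]`-bookkeeping: `|ψ′(z′) − ψ′(z₀)| = |U(B₀; z₀ → z′)ψ(z′) − ψ(z₀)|` for
`z′ ∈ □′₁`. [cite: Balaban1982Higgs2, p. 573 «After the gauge transformation we finally get …»] -/
theorem siteNorm_ψ'_sub {z' : ↥(boxDom m.M')} (hz' : z' ∈ m.sq1) :
    siteNorm (fld m.ψ' z' - fld m.ψ' m.z₀)
      = siteNorm (fieldLink fr.F m.κ m.A0b (m.emb' m.z₀) (m.emb' z') *ᵥ m.ψ z' - m.ψ m.z₀) := by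
  rw [m.fld_ψ', m.fld_ψ', m.fld_Ψ_of_mem hz', m.fld_Ψ_of_mem m.z₀_mem, m.fieldLink_A0b]
  set g0 := gaugeU d fr.F m.κ fr.ℓ m.k (M2 fr.ℓ m.M') m.A₀ (m.emb' m.z₀) with hg0
  set g1 := gaugeU d fr.F m.κ fr.ℓ m.k (M2 fr.ℓ m.M') m.A₀ (m.emb' z') with hg1
  have hid : g1ᵀ *ᵥ m.ψ z' - g0ᵀ *ᵥ m.ψ m.z₀ = g0ᵀ *ᵥ ((g0 * g1ᵀ) *ᵥ m.ψ z' - m.ψ m.z₀) := by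
    rw [mulVec_sub, mulVec_mulVec, ← Matrix.mul_assoc, (fr.F.isGauge fun _ : Unit => _) (), Matrix.one_mul]
  rw [hid, hg0]
  dsimp only [gaugeU]
  rw [fr.F.transpose_eq]
  exact siteNorm_flow fr.F _ _

/-- **THE VALUE (2.85) FOR THE INSTANCE**: `aL⁻²Σ_{y′}C^{(k)}(□; y, y′) = (1 + a⁻¹L²a_km²/(a_k + m²))⁻¹`.
[cite: Balaban1982Higgs2, (2.85) p. 575] -/
theorem kappa0_eq (y : ↥(boxDom (M2 fr.ℓ m.M'))) :
    fr.a₂ / ((fr.ℓ : ℝ) + 1) ^ 2 * ∑ y', m.X0⁻¹ y y'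
      = (1 + fr.a₂⁻¹ * ((fr.ℓ : ℝ) + 1) ^ 2 * (B1.aSeq m.a ((fr.ℓ : ℝ) + 1) m.k * m.m2
          / (B1.aSeq m.a ((fr.ℓ : ℝ) + 1) m.k + m.m2)))⁻¹ := by
  rw [covOp_inv_rowsum m.hn fr.ℓ m.hak m.hm1 fr.ha₂ m.hM' m.X0_isUnit y]
  have hL0 : ((fr.ℓ : ℝ) + 1) ≠ 0 := by positivity
  have h := B2StepK.display285 (a := fr.a₂) (L := (fr.ℓ : ℝ) + 1) (ak := B1.aSeq m.a ((fr.ℓ : ℝ) + 1) m.k)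
    (μ := m.m2) fr.ha₂.ne' hL0 (by have := m.hak; have := m.hm1; positivity)
  rw [← h, div_eq_mul_inv fr.a₂ (((fr.ℓ : ℝ) + 1) ^ 2)]

/-- **THE ZERO-FIELD MAIN TERM IS `ψ′(z₀)` UP TO `C_Z·q`**: decay of `C^{(k)}(□)` (PROVED, `B4BoxCov237`), the covariant
Lipschitz bound on `ψ′` over `□′₁`, the far part `e^{−δ_CR₁/2}t_ψ ≤ K₂`, and `|aL⁻²C^{(k)}1 − 1| ≤ (L²/a)μ₀²(L^kε)²` with
`μ₀²(L^kε)²t_ψ ≤ K_m` — exactly the steps (2.82)–(2.85) of Lemma 2.5, after the gauge.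
[cite: Balaban1982Higgs2, (2.82)–(2.85) pp. 574–575, (2.76) p. 573] -/
theorem mainZ_site_le (hR : m.Restr) (y : ↥(boxDom (M2 fr.ℓ m.M'))) (hy : cSite d fr.ℓ m.M' y = m.z₀) :
    siteNorm (m.mainZ y - fld m.ψ' m.z₀) ≤ fr.CZ * m.q := by
  have hq := m.q_nonneg; have ht := m.tψ_nonneg; have hδ := fr.δC_pos; have hcC := fr.cC_pos.le
  have hr₁ := fr.r₁_nonneg; have hr₂ := fr.r₂_nonneg; have ha₂ := fr.ha₂; have hm2 := m.hm1
  have hc : 0 ≤ fr.a₂ / ((fr.ℓ : ℝ) + 1) ^ 2 := by positivity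
  set c := fr.a₂ / ((fr.ℓ : ℝ) + 1) ^ 2 with hcdef
  set X := m.X0⁻¹ with hX
  set ψ0 := fld m.ψ' m.z₀ with hψ0
  have hψ0 : siteNorm ψ0 ≤ m.tψ * m.q := by
    rw [hψ0, m.siteNorm_fld_ψ', m.fld_Ψ_of_mem m.z₀_mem, ← m.ψΩ_inc _ m.z₀_mem]
    exact hR.bound _ (m.inc_mem _ m.z₀_mem)
  -- the decomposition (2.82)-style
  have hdec : m.mainZ y - ψ0 = c • ∑ y' : ↥(boxDom (M2 fr.ℓ m.M')), X y y' • (fld m.ψ' (cSite d fr.ℓ m.M' y') - ψ0)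
      + (c * ∑ y' : ↥(boxDom (M2 fr.ℓ m.M')), X y y' - 1) • ψ0 := by
    have h1 : ∑ y' : ↥(boxDom (M2 fr.ℓ m.M')), X y y' • (fld m.ψ' (cSite d fr.ℓ m.M' y') - ψ0)
        = ∑ y' : ↥(boxDom (M2 fr.ℓ m.M')), X y y' • fld m.ψ' (cSite d fr.ℓ m.M' y')
          - (∑ y' : ↥(boxDom (M2 fr.ℓ m.M')), X y y') • ψ0 := by
      rw [Finset.sum_smul, ← Finset.sum_sub_distrib]
      exact Finset.sum_congr rfl fun y' _ => smul_sub _ _ _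
    rw [m.mainZ_eq_sum, ← hcdef, ← hX, h1, smul_sub, sub_smul, one_smul, mul_smul]
    abel
  -- the per-term bound
  have hterm : ∀ y', |X y y'| * siteNorm (fld m.ψ' (cSite d fr.ℓ m.M' y') - ψ0)
      ≤ fr.cC * Real.exp (-(fr.δC * supNorm (y.1 - y'.1)))
          * (m.q * (fr.r₁ + fr.r₂ * (supNorm (y.1 - y'.1) / ((fr.ℓ : ℝ) + 1))))
        + fr.cC * (Real.exp (-(fr.δC / 2 * m.R₁)) * Real.exp (-(fr.δC / 2 * supNorm (y.1 - y'.1)))) * (m.tψ * m.q) := by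
    intro y'
    have hXe := m.X0_spec.2 y y'
    have hsn := supNorm_nonneg (y.1 - y'.1)
    have hA : 0 ≤ fr.cC * Real.exp (-(fr.δC * supNorm (y.1 - y'.1)))
        * (m.q * (fr.r₁ + fr.r₂ * (supNorm (y.1 - y'.1) / ((fr.ℓ : ℝ) + 1)))) := by positivity
    have hB : 0 ≤ fr.cC * (Real.exp (-(fr.δC / 2 * m.R₁)) * Real.exp (-(fr.δC / 2 * supNorm (y.1 - y'.1))))
        * (m.tψ * m.q) := by positivity
    by_cases hz : cSite d fr.ℓ m.M' y' ∈ m.sq1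
    · have hl := hR.lip y hy y' hz
      rw [m.siteNorm_ψ'_sub hz] at *
      calc |X y y'| * siteNorm (fieldLink fr.F m.κ m.A0b (m.emb' m.z₀) (m.emb' (cSite d fr.ℓ m.M' y')) *ᵥ
              m.ψ (cSite d fr.ℓ m.M' y') - m.ψ m.z₀)
          ≤ fr.cC * Real.exp (-(fr.δC * supNorm (y.1 - y'.1)))
              * (m.q * (fr.r₁ + fr.r₂ * (supNorm (y.1 - y'.1) / ((fr.ℓ : ℝ) + 1)))) :=
            mul_le_mul hXe hl (siteNorm_nonneg _) (by positivity)
        _ ≤ _ := le_add_of_nonneg_right hB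
    · have hfar := m.far1 y hy y' hz
      have h0 : fld m.ψ' (cSite d fr.ℓ m.M' y') = 0 := by
        rw [m.fld_ψ', m.fld_Ψ_of_not_mem hz, mulVec_zero]
      rw [h0, zero_sub, siteNorm_neg]
      have hexp : Real.exp (-(fr.δC * supNorm (y.1 - y'.1)))
          ≤ Real.exp (-(fr.δC / 2 * m.R₁)) * Real.exp (-(fr.δC / 2 * supNorm (y.1 - y'.1))) := by
        rw [← Real.exp_add, Real.exp_le_exp]; nlinarith
      calc |X y y'| * siteNorm ψ0
          ≤ fr.cC * (Real.exp (-(fr.δC / 2 * m.R₁)) * Real.exp (-(fr.δC / 2 * supNorm (y.1 - y'.1))))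
              * (m.tψ * m.q) :=
            mul_le_mul (hXe.trans (mul_le_mul_of_nonneg_left hexp hcC)) hψ0 (siteNorm_nonneg _) (by positivity)
        _ ≤ _ := le_add_of_nonneg_left hA
  -- summing
  have hS1 := sum_exp_supNorm_le hδ y (N := M2 fr.ℓ m.M')
  have hS2 := sum_exp_supNorm_mul_le hδ y (N := M2 fr.ℓ m.M')
  have hS3 := sum_exp_supNorm_le (half_pos hδ) y (N := M2 fr.ℓ m.M')
  have hsum : ∑ y', |X y y'| * siteNorm (fld m.ψ' (cSite d fr.ℓ m.M' y') - ψ0)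
      ≤ fr.cC * m.q * (fr.r₁ * Frame27.SS d fr.δC
            + fr.r₂ / ((fr.ℓ : ℝ) + 1) * (2 / fr.δC * Frame27.SS d (fr.δC / 2)))
        + fr.cC * fr.K₂ * m.q * Frame27.SS d (fr.δC / 2) := by
    refine (Finset.sum_le_sum fun y' _ => hterm y').trans ?_
    rw [Finset.sum_add_distrib]
    have e1 : ∑ y' : ↥(boxDom (M2 fr.ℓ m.M')), fr.cC * Real.exp (-(fr.δC * supNorm (y.1 - y'.1)))
          * (m.q * (fr.r₁ + fr.r₂ * (supNorm (y.1 - y'.1) / ((fr.ℓ : ℝ) + 1))))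
        = fr.cC * m.q * (fr.r₁ * ∑ y' : ↥(boxDom (M2 fr.ℓ m.M')), Real.exp (-(fr.δC * supNorm (y.1 - y'.1)))
          + fr.r₂ / ((fr.ℓ : ℝ) + 1) * ∑ y' : ↥(boxDom (M2 fr.ℓ m.M')),
              Real.exp (-(fr.δC * supNorm (y.1 - y'.1))) * supNorm (y.1 - y'.1)) := by
      rw [Finset.mul_sum, Finset.mul_sum, ← Finset.sum_add_distrib, Finset.mul_sum]
      exact Finset.sum_congr rfl fun y' _ => by ring
    have e2 : ∑ y' : ↥(boxDom (M2 fr.ℓ m.M')), fr.cC * (Real.exp (-(fr.δC / 2 * m.R₁))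
          * Real.exp (-(fr.δC / 2 * supNorm (y.1 - y'.1)))) * (m.tψ * m.q)
        = fr.cC * (Real.exp (-(fr.δC / 2 * m.R₁)) * m.tψ) * m.q
          * ∑ y' : ↥(boxDom (M2 fr.ℓ m.M')), Real.exp (-(fr.δC / 2 * supNorm (y.1 - y'.1))) := by
      rw [Finset.mul_sum]; exact Finset.sum_congr rfl fun y' _ => by ring
    rw [e1, e2]
    have f1 : fr.cC * m.q * (fr.r₁ * ∑ y' : ↥(boxDom (M2 fr.ℓ m.M')), Real.exp (-(fr.δC * supNorm (y.1 - y'.1)))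
          + fr.r₂ / ((fr.ℓ : ℝ) + 1) * ∑ y' : ↥(boxDom (M2 fr.ℓ m.M')),
              Real.exp (-(fr.δC * supNorm (y.1 - y'.1))) * supNorm (y.1 - y'.1))
        ≤ fr.cC * m.q * (fr.r₁ * Frame27.SS d fr.δC
            + fr.r₂ / ((fr.ℓ : ℝ) + 1) * (2 / fr.δC * Frame27.SS d (fr.δC / 2))) := by
      refine mul_le_mul_of_nonneg_left (add_le_add (mul_le_mul_of_nonneg_left hS1 hr₁)
        (mul_le_mul_of_nonneg_left hS2 (by positivity))) (by positivity)
    have f2 : fr.cC * (Real.exp (-(fr.δC / 2 * m.R₁)) * m.tψ) * m.q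
          * ∑ y' : ↥(boxDom (M2 fr.ℓ m.M')), Real.exp (-(fr.δC / 2 * supNorm (y.1 - y'.1)))
        ≤ fr.cC * fr.K₂ * m.q * Frame27.SS d (fr.δC / 2) :=
      mul_le_mul (mul_le_mul_of_nonneg_right (mul_le_mul_of_nonneg_left m.sepC hcC) hq) hS3
        (Finset.sum_nonneg fun _ _ => (Real.exp_pos _).le) (by have := fr.K₂_nonneg; positivity)
    exact add_le_add f1 f2
  -- the value (2.85)
  have hκ : |c * ∑ y', X y y' - 1| ≤ ((fr.ℓ : ℝ) + 1) ^ 2 / fr.a₂ * m.m2 := by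
    rw [hcdef, hX, m.kappa0_eq y]
    exact B2StepK.display285_bound fr.ha₂ m.hak m.hm1
  have hκψ : |c * ∑ y', X y y' - 1| * siteNorm ψ0 ≤ ((fr.ℓ : ℝ) + 1) ^ 2 / fr.a₂ * fr.Km * m.q := by
    calc |c * ∑ y', X y y' - 1| * siteNorm ψ0 ≤ ((fr.ℓ : ℝ) + 1) ^ 2 / fr.a₂ * m.m2 * (m.tψ * m.q) :=
          mul_le_mul hκ hψ0 (siteNorm_nonneg _) (by positivity)
      _ ≤ ((fr.ℓ : ℝ) + 1) ^ 2 / fr.a₂ * fr.Km * m.q := scale_le' (by positivity) hq m.m2_scale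
  -- assemble
  rw [hdec]
  refine (siteNorm_add_le _ _).trans ?_
  rw [siteNorm_smul, siteNorm_smul, abs_of_nonneg hc]
  have hmain : siteNorm (∑ y', X y y' • (fld m.ψ' (cSite d fr.ℓ m.M' y') - ψ0))
      ≤ ∑ y', |X y y'| * siteNorm (fld m.ψ' (cSite d fr.ℓ m.M' y') - ψ0) :=
    (siteNorm_sum_le _ _).trans (Finset.sum_le_sum fun y' _ => by rw [siteNorm_smul])
  refine (add_le_add (mul_le_mul_of_nonneg_left (hmain.trans hsum) hc) hκψ).trans (le_of_eq ?_)
  unfold Frame27.CZ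
  ring

/-! ### (T) the target `(Q^*(B̃)ψ)(y)` against its constant-field form -/

/-- **`U(B₀(Γ′_{z₀,y}))ᵀψ(z₀) = U(B₀(Γ_{y,·}))ψ′(z₀)`** — the constant-field target is the gauged `ψ′(z₀)`.
[cite: Balaban1982Higgs2, p. 573 «U(A₀(Γ_{x,y}))φ(y) = …»] -/
theorem target0_eq (y : ↥(boxDom (M2 fr.ℓ m.M'))) (hy : cSite d fr.ℓ m.M' y = m.z₀) :
    (transU d fr.F m.κ fr.ℓ m.k m.M' m.emb' m.Γ' m.A0b m.z₀ y)ᵀ *ᵥ m.ψ m.z₀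
      = gaugeU d fr.F m.κ fr.ℓ m.k (M2 fr.ℓ m.M') m.A₀ (m.emb y) *ᵥ fld m.ψ' m.z₀ := by
  rw [transU_constBond fr.F m.κ fr.ℓ m.k m.M' m.hend' m.A₀ hy, Matrix.transpose_mul, Matrix.transpose_transpose,
    ← mulVec_mulVec, m.fld_ψ', m.fld_Ψ_of_mem m.z₀_mem]

/-- **`|(Q^*(B̃)ψ)(y) − U(B₀(Γ_{y,·}))ψ′(z₀)| ≤ ℓ₁K_{τ′}·q`** (one transporter difference, `|ψ(z₀)| ≤ t_ψq`, `τ′t_ψ ≤ K_{τ′}`).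
[cite: Balaban1982Higgs2, p. 573 «U(A₀(Γ_{x,y}))φ(y) = U(A^{(k)}(Γ^{(k)}_{x,y}))φ(y) + O((L^kε)^{κ₀})», (2.113) p. 581] -/
theorem target_site_le (hR : m.Restr) (y : ↥(boxDom (M2 fr.ℓ m.M'))) (hy : cSite d fr.ℓ m.M' y = m.z₀) :
    siteNorm (gaugeU d fr.F m.κ fr.ℓ m.k (M2 fr.ℓ m.M') m.A₀ (m.emb y) *ᵥ fld m.ψ' m.z₀ - m.target y)
      ≤ fr.ℓ₁ * fr.Kτ' * m.q := by
  have hq := m.q_nonneg; have hℓ₁ := fr.hℓ₁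
  have hψ : siteNorm (m.ψ m.z₀) ≤ m.tψ * m.q := by
    rw [← m.ψΩ_inc _ m.z₀_mem]; exact hR.bound _ (m.inc_mem _ m.z₀_mem)
  have hqz : blkWt (fr.ℓ + 1) m.M' (M2 fr.ℓ m.M') m.z₀ y ≠ 0 := by
    rw [blkWtU_eq_ite, if_pos hy.symm]; exact one_ne_zero
  rw [← m.target0_eq y hy]
  dsimp only [target, transU]
  rw [← sub_mulVec, ← Matrix.transpose_sub, transport_fieldLink, transport_fieldLink]
  have hsplit : lsum m.At (m.emb' m.z₀) (m.Γ' m.z₀ y) = lsum m.A0b (m.emb' m.z₀) (m.Γ' m.z₀ y)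
      + lsum m.A' (m.emb' m.z₀) (m.Γ' m.z₀ y) := lsum_add _ _ _ _
  rw [hsplit, mul_add, ← neg_sub, Matrix.transpose_neg, neg_mulVec, siteNorm_neg]
  refine (siteNorm_flow_add_sub_transpose_le fr.F fr.hℓ₁ fr.hLip _ _ _).trans ?_
  calc fr.ℓ₁ * |m.κ * lsum m.A' (m.emb' m.z₀) (m.Γ' m.z₀ y)| * siteNorm (m.ψ m.z₀)
      ≤ fr.ℓ₁ * m.τ' * (m.tψ * m.q) :=
        mul_le_mul (mul_le_mul_of_nonneg_left (m.hτA' _ _ hqz) hℓ₁) hψ (siteNorm_nonneg _) (mul_nonneg hℓ₁ m.hτ')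
    _ ≤ fr.ℓ₁ * fr.Kτ' * m.q := scale_le' hℓ₁ hq m.τ'_scale

/-! ### (O) the localization (Proposition I.2.3 shapes, the engine of (2.67)) -/

/-- the box object in kernel form: `(aL⁻²C^{(k)}(□,B̃)Q^*(B̃)□′₁ψ)(y) = Σ_{z′}K_□(y,z′)□′₁ψ(z′)`.
[cite: Balaban1982Higgs2, (2.113) p. 581] -/
theorem fld_obj (y : ↥(boxDom (M2 fr.ℓ m.M'))) :
    fld m.obj y = ∑ z', kerBox27 d fr.F m.κ fr.ℓ m.k fr.a₂ m.a m.m2 m.M' m.emb m.Γ m.emb' m.Γ' m.At y z' *ᵥ fld m.Ψ z' :=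
  fld_mulVec_blocks' _ _ y

/-- **THE LOCALIZATION AT A SITE OF `B(z₀)`**: `|(aL⁻²C^{(k)}_{Λ₄}(…,B̃)Q^*(B̃)ψ)(y) − (aL⁻²C^{(k)}(□,B̃)Q^*(B̃)□′₁ψ)(y)| ≤
c_OS_O(K₅ + K₄)·q` from the `δC^{(k)}`-clause shapes (as (2.67) for Lemma 2.4).
[cite: Balaban1982Higgs2, (2.67) p. 572; Balaban1982Higgs1, Prop. 2.3 (1.18) p. 611] -/
theorem outer_le (hR : m.Restr) (y : ↥(boxDom (M2 fr.ℓ m.M'))) (hy : cSite d fr.ℓ m.M' y = m.z₀) :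
    siteNorm (m.objΩ y - fld m.obj y) ≤ fr.cO * fr.SO * (fr.K₅ + fr.K₄) * m.q := by
  dsimp only [objΩ]
  rw [m.fld_obj]
  have h := outer_engine (ι := ι) m.sq1 m.Tout m.inc m.inc_inj m.inc_mem (m.KΩ y)
    (kerBox27 d fr.F m.κ fr.ℓ m.k fr.a₂ m.a m.m2 m.M' m.emb m.Γ m.emb' m.Γ' m.At y) m.ψ m.ψΩ m.ψΩ_inc
    (fun z' => fld m.Ψ z') (fun z' hz' => m.fld_Ψ_of_mem hz') (fun z' hz' => m.fld_Ψ_of_not_mem hz') fr.cO_nonneg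
    fr.δO_pos (mul_nonneg m.tψ_nonneg m.q_nonneg) (m.dΩ y) (m.dΩ_nonneg y) (m.summableΩ y) (m.kerΩ_far y hy)
    (m.farΩ y hy) (m.kerΩ_near y hy) hR.bound
  refine h.trans ?_
  have hcS : 0 ≤ fr.cO * fr.SO := mul_nonneg fr.cO_nonneg fr.SO_nonneg
  have e1 : fr.cO * fr.SO * (Real.exp (-(fr.δO * m.R₄)) * (m.tψ * m.q)) ≤ fr.cO * fr.SO * fr.K₅ * m.q := by
    have := mul_le_mul_of_nonneg_right m.sepO₄ m.q_nonneg
    nlinarith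
  have e2 : fr.cO * fr.SO * (Real.exp (-(fr.δO / 2 * m.R₂)) * (m.tψ * m.q)) ≤ fr.cO * fr.SO * fr.K₄ * m.q := by
    have := mul_le_mul_of_nonneg_right m.sepO₂ m.q_nonneg
    nlinarith
  linarith

/-! ### (Σ) assembly -/

/-- **(2.113) AT A UNIT SITE OF `B(z₀)`**: `|aL⁻²(C^{(k)}_{Λ₄}(B^k(Λ₂),B̃)Q^*(B̃)ψ)(y) − (Q^*(B̃)ψ)(y)| ≤ C27·q`, combining the
localization (O), the expansion in `B′` (E), the gauge-away of `B₀` (G), the zero-field estimate (Z) and the target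
comparison (T) — the reconstruction of the omitted proof «based on the ideas … of Lemmas 2.4 and 2.5».
[cite: Balaban1982Higgs2, Lemma 2.7 (2.113) p. 581] -/
theorem dev_site_le (hR : m.Restr) (y : ↥(boxDom (M2 fr.ℓ m.M'))) (hy : cSite d fr.ℓ m.M' y = m.z₀) :
    siteNorm (m.objΩ y - m.target y) ≤ fr.C27 * m.q := by
  set g := gaugeU d fr.F m.κ fr.ℓ m.k (M2 fr.ℓ m.M') m.A₀ (m.emb y) with hg
  have h1 := m.outer_le hR y hy
  have h2 : siteNorm (fld m.obj y - fld m.obj0 y) ≤ fr.CE * m.q := by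
    rw [← fld_sub]; exact (le_supN _ y).trans (m.obj_sub_obj0_le hR)
  have h3 : siteNorm (fld m.obj0 y - g *ᵥ fld m.ψ' m.z₀) ≤ fr.CZ * m.q := by
    rw [m.fld_obj0, hg, ← mulVec_sub]
    dsimp only [gaugeU]
    rw [siteNorm_flow]
    exact m.mainZ_site_le hR y hy
  have h4 := m.target_site_le hR y hy
  have hsplit : m.objΩ y - m.target y = (m.objΩ y - fld m.obj y) + (fld m.obj y - fld m.obj0 y)
      + (fld m.obj0 y - g *ᵥ fld m.ψ' m.z₀) + (g *ᵥ fld m.ψ' m.z₀ - m.target y) := by abel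
  rw [hsplit]
  refine ((siteNorm_add_le _ _).trans (add_le_add ((siteNorm_add_le _ _).trans (add_le_add
    ((siteNorm_add_le _ _).trans (add_le_add h1 h2)) h3)) h4)).trans (le_of_eq ?_)
  unfold Frame27.C27
  ring

/-- the supremum over `B(z₀)`: `dev2113 ≤ C27·q`. [cite: Balaban1982Higgs2, (2.113) p. 581] -/
theorem dev2113_le (hR : m.Restr) : m.dev2113 ≤ fr.C27 * m.q :=
  Real.iSup_le (fun y => m.dev_site_le hR y.1 y.2) (mul_nonneg fr.C27_nonneg m.q_nonneg)

end Model27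

/-- **LEMMA 2.7 FOR THE MODEL FAMILY, EXPLICIT CONSTANT**: every instance obeying the restrictions has
`dev2113 ≤ (K₃·C27)·p(L^kε)`. [cite: Balaban1982Higgs2, Lemma 2.7 (2.113) p. 581] -/
theorem lemma27_bound (fr : Frame27 ι d) (Yo : Type) [Fintype Yo] [DecidableEq Yo] (m : Model27 fr Yo)
    (hR : m.Restr) : m.dev2113 ≤ fr.K₃ * fr.C27 * m.p := by
  have h := m.dev2113_le hR
  have := mul_le_mul_of_nonneg_left m.q_le fr.C27_nonneg
  nlinarith [fr.C27_nonneg, fr.K₃_nonneg, m.p_nonneg]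

/-! ### Row B2.Lem2.7: the decls of record for the model family -/

/-- the row's carrier filled by an instance: `p` ↤ `p(L^kε)`, `restrψ` ↤ `Model27.Restr`, `dev2113` ↤ the printed supremum
over `B(z₀)`. [cite: Balaban1982Higgs2, Lemma 2.7 (2.113) p. 581] -/
noncomputable def famOf27 (fr : Frame27 ι d) (Yo : Type) [Fintype Yo] [DecidableEq Yo] (m : Model27 fr Yo) :
    B2Sect2Statements.L27Setting where
  p := m.p
  restrψ := m.Restr
  dev2113 := m.dev2113

/-- **ROW B2.Lem2.7 — [Balaban1982Higgs2] LEMMA 2.7 (2.113), THE DECL OF RECORD `B2Sect2Statements.Lemma27Printed`, PROVED FOR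
THE MODEL FAMILY** (one constant `C = K₃·C27` for all instances of a frame; the proof is our RECONSTRUCTION of the omitted
one). [cite: Balaban1982Higgs2, Lemma 2.7 (2.113) p. 581] -/
theorem lemma27Printed_model (fr : Frame27 ι d) (Yo : Type) [Fintype Yo] [DecidableEq Yo] :
    B2Sect2Statements.Lemma27Printed (famOf27 fr Yo) :=
  ⟨fr.K₃ * fr.C27, fun m hR => lemma27_bound fr Yo m hR⟩

/-- a component is at most the Euclidean site norm. [cite: Balaban1982Higgs2, (2.113) p. 581 «|·|»] -/
theorem abs_apply_le_siteNorm (v : ι → ℝ) (i : ι) : |v i| ≤ siteNorm v := by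
  unfold siteNorm
  rw [← Real.sqrt_sq_eq_abs]
  refine Real.sqrt_le_sqrt ?_
  rw [dotProduct, ← Finset.sum_erase_add _ _ (Finset.mem_univ i), sq]
  exact le_add_of_nonneg_left (Finset.sum_nonneg fun j _ => mul_self_nonneg (v j))

/-- the twin carrier of r14 (`B2StepK.L27Setting`: real-valued quantities at the points `x ∈ Λ₅`) filled by an instance:
points = (unit site of `B(z₀)`, colour component). [cite: Balaban1982Higgs2, Lemma 2.7 (2.113) p. 581] -/
noncomputable def famOf27StepK (fr : Frame27 ι d) (Yo : Type) [Fintype Yo] [DecidableEq Yo] (m : Model27 fr Yo) :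
    B2StepK.L27Setting where
  X := {y : ↥(boxDom (M2 fr.ℓ m.M')) // cSite d fr.ℓ m.M' y = m.z₀} × ι
  inL5 := fun _ => True
  CQsψ := fun x => m.objΩ x.1.1 x.2
  Qsψ := fun x => m.target x.1.1 x.2
  p := m.p
  restr := m.Restr

/-- **THE TWIN DECL OF RECORD `B2StepK.Lemma27Printed` FOR THE MODEL FAMILY** (via r14's bridge
`B2StepKSect2Bridge.lemma27Printed_of_sect2`). [cite: Balaban1982Higgs2, Lemma 2.7 (2.113) p. 581] -/
theorem lemma27Printed_model_StepK (fr : Frame27 ι d) (Yo : Type) [Fintype Yo] [DecidableEq Yo] :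
    B2StepK.Lemma27Printed (famOf27StepK fr Yo) := by
  refine B2StepKSect2Bridge.lemma27Printed_of_sect2 (famOf27StepK fr Yo) (famOf27 fr Yo) (fun _ => rfl)
    (fun _ h => h) (fun m x _ => ?_) (lemma27Printed_model fr Yo)
  show |m.objΩ x.1.1 x.2 - m.target x.1.1 x.2| ≤ m.dev2113
  have h1 : |m.objΩ x.1.1 x.2 - m.target x.1.1 x.2| ≤ siteNorm (m.objΩ x.1.1 - m.target x.1.1) :=
    abs_apply_le_siteNorm (m.objΩ x.1.1 - m.target x.1.1) x.2
  refine h1.trans ?_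
  exact le_ciSup (f := fun y : {y : ↥(boxDom (M2 fr.ℓ m.M')) // cSite d fr.ℓ m.M' y = m.z₀} =>
    siteNorm (m.objΩ y.1 - m.target y.1)) (Set.finite_range _).bddAbove x.1

end Final

end

end Literature.MathematicalPhysics.QuantumFieldTheory.Balaban1983to89.B2Lemma27Proof
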